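import Literature.Topology.FourManifolds.InvertedModel
import Literature.Topology.FourManifolds.ConcordanceSurfaceReplacement
import HarnessLib

/-!
# The two-sided surface detour: a straightened concordance inserted into a band sum

Topic `Literature/Topology/FourManifolds`; step V5-4 of the proof programme of the Fox–Milnor
fact `Literature.Topology.FourManifolds.Knot.exists_isConnectedSum_isConcordant`. Everything
here is proved; no named fact is introduced.

Given a long annulus `D` with a flat strip (`StripPicture`, `InvertedModel.lean`), sizes
`am, l, δ` and a tube fit, the model data `md` of the inverted lower end knot yields the chart
`C = md.chart`, the segment data `md.seg'`, the two knot pieces `P₁ = md.piece` (lower end) and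
`P₂ = piece₂` (upper end) over the **same** chart, and their product surface detours
(`Detour.toSurfaceDetour`, `ConcordanceSurfaceReplacement.lean`). The **two-sided surface
detour** `surfaceDetour` is the lower product detour *corrected on the body range*: there the
static small knot is replaced by the moving inverted picture
`(u, s) ↦ md.T (Ψ (D.F (θ̂ v / 2π, s)).1)` at the time `(D.F (θ̂ v / 2π, s)).2` (`v` the reduced
parameter), cut off by a function `χ` of `θ̂ v` and periodised (`periodise`,
`CurveFamilyIsotopy.lean`). Since the flat strip is static at all levels, the correction vanishes
wherever the cut-off is not `1`, so the surface is, pointwise, either the static detour or the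
moving picture; its slices at `s = 1` and `s = 2` are the detours of `P₁` and `P₂`
(`surfaceDetour_c_one`, `surfaceDetour_c_two`). Embeddedness: static against static is the
detour's, moving against moving is the annulus', moving body against static core and arches is a
height comparison, and moving body against the static strip is again the annulus' injectivity
(the strip is a level-true part of the same annulus).

## References

* R. H. Fox, J. W. Milnor, Osaka J. Math. 3 (1966), §1. [FoxMilnor1966]

## Design notes

No named facts, no `sorry`; `𝔼 n`, `𝕊 n` are local notation as in `Knots.lean`.
-/

open scoped Manifold Topology ContDiff Real RealInnerProductSpace
open Function Set Metric Filter

noncomputable section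

namespace Literature.Topology.FourManifolds

/-- Local notation: `𝔼 n` is the model Euclidean space `EuclideanSpace ℝ (Fin n)`. -/
local notation "𝔼 " n:arg => EuclideanSpace ℝ (Fin n)

/-- Local notation: `𝕊 n` is the unit sphere in `EuclideanSpace ℝ (Fin (n + 1))`. -/
local notation "𝕊 " n:arg => (Metric.sphere (0 : EuclideanSpace ℝ (Fin (n + 1))) 1)

attribute [local instance] fact_finrank_euclideanSpace_succ

open KnotsInBall FoxMilnorModel InvertedPicture BandFoliation StripFrame

namespace StripPicture

variable {ηD : ℝ} {D : LongAnnulus ηD} (S : StripPicture D)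

section

variable (sg : ℝ) (hsg : sg ^ 2 = 1) (am l δ : ℝ) (ham : 0 < am) (hl : 0 < l) (hδ : 0 < δ) (hδ8 : δ ≤ 1 / 8)
    (hl_le : 16 * l * (‖S.x₀‖ + 2 * S.a + 1) ≤ am)
    (hδ_room : δ * (16 * am * (‖S.x₀‖ + 2 * S.a + 1)) ≤ l)
    (hδ_up : δ * (16 * (‖S.x₀‖ + 2 * S.a + 1) ^ 2) < 1)
    (hδ_clean : δ * (2 * am) ≤ l * (S.a / 4))

/-! ### The moving picture in model coordinates -/

/-- **The moving picture**: position `md.T (Ψ (D.F (θ, s)).1)` and time `(D.F (θ, s)).2`. [folklore] -/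
def moving (p : ℝ × ℝ) : 𝔼 3 × ℝ :=
  ((S.md sg hsg am l δ ham hl hδ hδ8 hl_le hδ_room hδ_up hδ_clean).T (S.Ψ (D.F p).1), (D.F p).2)

/-- The moving picture is `C^∞`. [folklore] -/
theorem contDiff_moving : ContDiff ℝ ∞ (S.moving sg hsg am l δ ham hl hδ hδ8 hl_le hδ_room hδ_up hδ_clean) := by
  obtain ⟨hφ, -, -, hw₂, hsupp, -⟩ := S.φ_facts
  have hΨF : ContDiff ℝ ∞ fun p : ℝ × ℝ ↦ S.Ψ (D.F p).1 := by
    rw [contDiff_iff_contDiffAt]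
    intro p
    exact (contDiffAt_Ψ hφ hw₂ hsupp (S.pos_ne_ctr p.1 p.2)).comp p
      (contDiffAt_fst.comp p D.contDiff_F.contDiffAt)
  exact ((Knot.IsConicalConcordance.contDiff_affT _ _ _ _).comp hΨF).prodMk (contDiff_snd.comp D.contDiff_F)

/-- The moving picture is `1`-periodic in `θ`. [folklore] -/
theorem moving_add_int (θ s : ℝ) (m : ℤ) :
    S.moving sg hsg am l δ ham hl hδ hδ8 hl_le hδ_room hδ_up hδ_clean (θ + m, s) =
      S.moving sg hsg am l δ ham hl hδ hδ8 hl_le hδ_room hδ_up hδ_clean (θ, s) := by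
  simp [moving, D.F_add_int]

/-- The lower knot piece at `2πθ` is the moving position over `(θ, 1)`. [folklore] -/
theorem piece_k_eq (θ : ℝ) :
    (S.md sg hsg am l δ ham hl hδ hδ8 hl_le hδ_room hδ_up hδ_clean).piece.k (2 * π * θ) =
      (S.md sg hsg am l δ ham hl hδ hδ8 hl_le hδ_room hδ_up hδ_clean).T (S.Ψ (D.F (θ, 1)).1) := by
  rw [ModelData.piece_k, ModelData.k_apply]
  show (S.md sg hsg am l δ ham hl hδ hδ8 hl_le hδ_room hδ_up hδ_clean).T (psi (S.Kn₁ (circlePoint (2 * π * θ)))) = _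
  rw [S.psi_Kn₁, D.k₁_eq, ← mul_assoc, inv_mul_cancel₀ (by positivity), one_mul]

/-- The upper knot piece at `2πθ` is the moving position over `(θ, 2)`. [folklore] -/
theorem piece₂_k_eq (θ : ℝ) :
    (S.piece₂ sg hsg am l δ ham hl hδ hδ8 hl_le hδ_room hδ_up hδ_clean).k (2 * π * θ) =
      (S.md sg hsg am l δ ham hl hδ hδ8 hl_le hδ_room hδ_up hδ_clean).T (S.Ψ (D.F (θ, 2)).1) := by
  rw [piece₂_k, k₂', Knot.chartCurve_apply, S.psi_Kn₂, D.k₂_eq, ← mul_assoc, inv_mul_cancel₀ (by positivity),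
    one_mul]

/-- **On the strip the moving picture is static**: over a strip parameter it is the lower knot
piece at the true time. [folklore] -/
theorem moving_of_strip {θ : ℝ} (hθ : ∃ m : ℤ, |θ - S.θ₁ - m| < S.δ₁) (s : ℝ) :
    S.moving sg hsg am l δ ham hl hδ hδ8 hl_le hδ_room hδ_up hδ_clean (θ, s) =
      ((S.md sg hsg am l δ ham hl hδ hδ8 hl_le hδ_room hδ_up hδ_clean).piece.k (2 * π * θ), s) := by
  obtain ⟨m, hm⟩ := hθ
  rw [moving, piece_k_eq, S.strip θ s m hm, S.strip θ 1 m hm]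

/-- The same, read as the upper knot piece. [folklore] -/
theorem moving_of_strip₂ {θ : ℝ} (hθ : ∃ m : ℤ, |θ - S.θ₁ - m| < S.δ₁) (s : ℝ) :
    S.moving sg hsg am l δ ham hl hδ hδ8 hl_le hδ_room hδ_up hδ_clean (θ, s) =
      ((S.piece₂ sg hsg am l δ ham hl hδ hδ8 hl_le hδ_room hδ_up hδ_clean).k (2 * π * θ), s) := by
  obtain ⟨m, hm⟩ := hθ
  rw [moving, piece₂_k_eq, S.strip θ s m hm, S.strip θ 2 m hm]

/-- **The moving picture is injective modulo the period** over levels in `[1, 2]`. [folklore] -/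
theorem moving_inj {p q : ℝ × ℝ} (hp : p.2 ∈ Icc (1 : ℝ) 2) (hq : q.2 ∈ Icc (1 : ℝ) 2)
    (h : S.moving sg hsg am l δ ham hl hδ hδ8 hl_le hδ_room hδ_up hδ_clean p =
      S.moving sg hsg am l δ ham hl hδ hδ8 hl_le hδ_room hδ_up hδ_clean q) :
    p.2 = q.2 ∧ ∃ m : ℤ, q.1 = p.1 + m := by
  simp only [moving, Prod.mk.injEq] at h
  obtain ⟨h1, h2⟩ := h
  have hpos : (D.F p).1 = (D.F q).1 :=
    Ψ_injective S.e_two S.a_pos.ne' ((S.md sg hsg am l δ ham hl hδ hδ8 hl_le hδ_room hδ_up hδ_clean).injective_T h1)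
  exact D.inj p q hp hq (Prod.ext hpos h2)

/-- **The height of a moving body point**: over a non-strip parameter the model height is at
least `am + l (5a/8)`. [folklore] -/
theorem height_moving_body {θ : ℝ} (hθ : ∀ m : ℤ, S.δ₁ ≤ |θ - S.θ₁ - m|) (s : ℝ) :
    am + l * (5 * S.a / 8) ≤ (S.moving sg hsg am l δ ham hl hδ hδ8 hl_le hδ_room hδ_up hδ_clean (θ, s)).1 1 := by
  have hfar : S.r' ≤ ‖(D.F (θ, s)).1 - S.x₀‖ := by
    by_contra hlt
    obtain ⟨m, hm⟩ := S.bodyFree θ s (not_le.1 hlt)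
    exact (not_lt.2 (hθ m)) hm
  have h := S.height_far' hfar
  show am + l * (5 * S.a / 8) ≤ (S.md sg hsg am l δ ham hl hδ hδ8 hl_le hδ_room hδ_up hδ_clean).T (S.Ψ (D.F (θ, s)).1) 1
  rw [ModelData.T_apply_one]
  have ha : (S.md sg hsg am l δ ham hl hδ hδ8 hl_le hδ_room hδ_up hδ_clean).a = am := rfl
  have hp : (S.md sg hsg am l δ ham hl hδ hδ8 hl_le hδ_room hδ_up hδ_clean).p = S.x₀ := rfl
  have hl' : (S.md sg hsg am l δ ham hl hδ hδ8 hl_le hδ_room hδ_up hδ_clean).l = l := rfl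
  rw [ha, hp, hl']
  nlinarith

/-- **A moving body point is not a strip point of the picture at any time**: if the moving
position over a non-strip parameter `(θ, s)` equals the (static) position over a strip parameter
`θ'`, and the moving time is `t`, then `D.F (θ, s) = D.F (θ', t)`. [folklore] -/
theorem F_eq_of_moving_eq_strip {θ θ' s t : ℝ} (hθ' : ∃ m : ℤ, |θ' - S.θ₁ - m| < S.δ₁)
    (hpos : (S.moving sg hsg am l δ ham hl hδ hδ8 hl_le hδ_room hδ_up hδ_clean (θ, s)).1 =
      (S.md sg hsg am l δ ham hl hδ hδ8 hl_le hδ_room hδ_up hδ_clean).piece.k (2 * π * θ'))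
    (ht : (S.moving sg hsg am l δ ham hl hδ hδ8 hl_le hδ_room hδ_up hδ_clean (θ, s)).2 = t) :
    D.F (θ, s) = D.F (θ', t) := by
  have hm := S.moving_of_strip sg hsg am l δ ham hl hδ hδ8 hl_le hδ_room hδ_up hδ_clean hθ' t
  have : S.moving sg hsg am l δ ham hl hδ hδ8 hl_le hδ_room hδ_up hδ_clean (θ, s) =
      S.moving sg hsg am l δ ham hl hδ hδ8 hl_le hδ_room hδ_up hδ_clean (θ', t) := by
    rw [hm]; exact Prod.ext hpos ht
  simp only [moving, Prod.mk.injEq] at this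
  obtain ⟨h1, h2⟩ := this
  have hp : (D.F (θ, s)).1 = (D.F (θ', t)).1 :=
    Ψ_injective S.e_two S.a_pos.ne' ((S.md sg hsg am l δ ham hl hδ hδ8 hl_le hδ_room hδ_up hδ_clean).injective_T h1)
  exact Prod.ext hp h2

/-- **Coordinates of the moving picture**: `|y 0| ≤ 2 l ρ'`, `am ≤ y 1 ≤ am + 2 l ρ'`,
`|y 2| ≤ 2 l ρ'` (`ρ' = ‖x₀‖ + 2a + 1`). [folklore] -/
theorem moving_bounds (p : ℝ × ℝ) :
    |(S.moving sg hsg am l δ ham hl hδ hδ8 hl_le hδ_room hδ_up hδ_clean p).1 0| ≤ 2 * l * (‖S.x₀‖ + 2 * S.a + 1) ∧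
    am ≤ (S.moving sg hsg am l δ ham hl hδ hδ8 hl_le hδ_room hδ_up hδ_clean p).1 1 ∧
    (S.moving sg hsg am l δ ham hl hδ hδ8 hl_le hδ_room hδ_up hδ_clean p).1 1 ≤ am + 2 * l * (‖S.x₀‖ + 2 * S.a + 1) ∧
    |(S.moving sg hsg am l δ ham hl hδ hδ8 hl_le hδ_room hδ_up hδ_clean p).1 2| ≤ 2 * l * (‖S.x₀‖ + 2 * S.a + 1) := by
  set z := S.Ψ (D.F p).1 with hz
  have hp : (S.md sg hsg am l δ ham hl hδ hδ8 hl_le hδ_room hδ_up hδ_clean).p = S.x₀ := rfl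
  have hl' : (S.md sg hsg am l δ ham hl hδ hδ8 hl_le hδ_room hδ_up hδ_clean).l = l := rfl
  have ha : (S.md sg hsg am l δ ham hl hδ hδ8 hl_le hδ_room hδ_up hδ_clean).a = am := rfl
  have hb : ‖z - (S.md sg hsg am l δ ham hl hδ hδ8 hl_le hδ_room hδ_up hδ_clean).p‖ ≤ 2 * (‖S.x₀‖ + 2 * S.a + 1) := by
    rw [hp]
    have h1 : ‖z‖ ≤ ‖S.x₀‖ + 2 * S.a := S.norm_Ψ_le p.1 p.2
    calc ‖z - S.x₀‖ ≤ ‖z‖ + ‖S.x₀‖ := norm_sub_le _ _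
      _ ≤ 2 * (‖S.x₀‖ + 2 * S.a + 1) := by linarith [S.a_pos]
  have h0 := (S.md sg hsg am l δ ham hl hδ hδ8 hl_le hδ_room hδ_up hδ_clean).abs_M_apply_le (z - (S.md sg hsg am l δ ham hl hδ hδ8 hl_le hδ_room hδ_up hδ_clean).p) 0
  have h1 := (S.md sg hsg am l δ ham hl hδ hδ8 hl_le hδ_room hδ_up hδ_clean).abs_M_apply_le (z - (S.md sg hsg am l δ ham hl hδ hδ8 hl_le hδ_room hδ_up hδ_clean).p) 1
  have h2 := (S.md sg hsg am l δ ham hl hδ hδ8 hl_le hδ_room hδ_up hδ_clean).abs_M_apply_le (z - (S.md sg hsg am l δ ham hl hδ hδ8 hl_le hδ_room hδ_up hδ_clean).p) 2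
  have hlow : S.x₀ 2 ≤ z 2 := S.lowest p.1 p.2
  have hm : (S.moving sg hsg am l δ ham hl hδ hδ8 hl_le hδ_room hδ_up hδ_clean p).1 = (S.md sg hsg am l δ ham hl hδ hδ8 hl_le hδ_room hδ_up hδ_clean).T z := rfl
  rw [hm]
  refine ⟨?_, ?_, ?_, ?_⟩
  · rw [ModelData.T_apply_coord, hl']
    simp only [Fin.zero_eq_one_iff, OfNat.ofNat_ne_one, if_false, zero_add]
    rw [abs_mul, abs_of_pos hl]; nlinarith
  · rw [ModelData.T_apply_one, ha, hl', hp]; nlinarith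
  · rw [ModelData.T_apply_coord, hl', ha]
    simp only [if_true]
    nlinarith [le_abs_self ((S.md sg hsg am l δ ham hl hδ hδ8 hl_le hδ_room hδ_up hδ_clean).M (z - (S.md sg hsg am l δ ham hl hδ hδ8 hl_le hδ_room hδ_up hδ_clean).p) 1)]
  · rw [ModelData.T_apply_coord, hl']
    simp only [show (2 : Fin 3) ≠ 1 by decide, if_false, zero_add]
    rw [abs_mul, abs_of_pos hl]; nlinarith

/-! ### The windows and the cut-off -/

/-- The zone of the strip in the parameter of the small knot: `t / 2π` is a strip parameter. [folklore] -/
def Zone (t : ℝ) : Prop := ∃ m : ℤ, |(2 * π)⁻¹ * t - S.θ₁ - m| < S.δ₁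

/-- The gap `2πδ₁ - a/16 > 0` between the window and the zone ends. [folklore] -/
def gap : ℝ := 2 * π * S.δ₁ - S.a / 16

/-- `0 < gap`. [folklore] -/
theorem gap_pos : 0 < S.gap := by rw [gap]; linarith [S.window_lt]

/-- Parameters in `(2π(θ₁ - δ₁), 2π(θ₁ + δ₁))` are in the zone. [folklore] -/
theorem zone_of_mem₀ {t : ℝ} (ht : t ∈ Ioo (2 * π * (S.θ₁ - S.δ₁)) (2 * π * (S.θ₁ + S.δ₁))) : S.Zone t := by
  refine ⟨0, ?_⟩
  have hπ : 0 < 2 * π := by positivity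
  simp only [Int.cast_zero, sub_zero]
  rw [abs_lt]
  constructor
  · have : S.θ₁ - S.δ₁ < (2 * π)⁻¹ * t := by rw [lt_inv_mul_iff₀ hπ]; exact ht.1
    linarith
  · have : (2 * π)⁻¹ * t < S.θ₁ + S.δ₁ := by rw [inv_mul_lt_iff₀ hπ]; exact ht.2
    linarith

/-- Parameters one period up are in the zone. [folklore] -/
theorem zone_of_mem₁ {t : ℝ} (ht : t ∈ Ioo (2 * π * (S.θ₁ - S.δ₁) + 2 * π) (2 * π * (S.θ₁ + S.δ₁) + 2 * π)) :
    S.Zone t := by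
  refine ⟨1, ?_⟩
  have hπ : 0 < 2 * π := by positivity
  simp only [Int.cast_one]
  rw [abs_lt]
  constructor
  · have : S.θ₁ - S.δ₁ + 1 < (2 * π)⁻¹ * t := by
      rw [lt_inv_mul_iff₀ hπ]; nlinarith [ht.1]
    linarith
  · have : (2 * π)⁻¹ * t < S.θ₁ + S.δ₁ + 1 := by
      rw [inv_mul_lt_iff₀ hπ]; nlinarith [ht.2]
    linarith

/-- **A non-zone parameter between the window ends lies in `[2π(θ₁+δ₁), 2π(θ₁-δ₁)+2π]`.** [folklore] -/
theorem mem_of_not_zone {t : ℝ} (h1 : 2 * π * (S.θ₁ - S.δ₁) < t) (h2 : t < 2 * π * (S.θ₁ + S.δ₁) + 2 * π)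
    (hz : ¬ S.Zone t) : t ∈ Icc (2 * π * (S.θ₁ + S.δ₁)) (2 * π * (S.θ₁ - S.δ₁) + 2 * π) := by
  by_contra h
  rw [mem_Icc, not_and_or, not_le, not_le] at h
  rcases h with h | h
  · exact hz (S.zone_of_mem₀ ⟨h1, h⟩)
  · exact hz (S.zone_of_mem₁ ⟨h, h2⟩)

/-- **The cut-off** of the body range, as a function of the reduced parameter `v`: `1` when
`θ̂ v ∈ [β + 2 gap/3, α + 2π - 2 gap/3]`, `0` when `θ̂ v ∉ (β + gap/3, α + 2π - gap/3)`. [folklore] -/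
def χ (v : ℝ) : ℝ :=
  Real.smoothTransition (((S.md sg hsg am l δ ham hl hδ hδ8 hl_le hδ_room hδ_up hδ_clean).seg'.θhat v - ((S.md sg hsg am l δ ham hl hδ hδ8 hl_le hδ_room hδ_up hδ_clean).seg'.β + S.gap / 3)) / (S.gap / 3)) *
    Real.smoothTransition (((S.md sg hsg am l δ ham hl hδ hδ8 hl_le hδ_room hδ_up hδ_clean).seg'.α + 2 * π - S.gap / 3 - (S.md sg hsg am l δ ham hl hδ hδ8 hl_le hδ_room hδ_up hδ_clean).seg'.θhat v) / (S.gap / 3))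

/-- The cut-off is `C^∞`. [folklore] -/
theorem contDiff_χ : ContDiff ℝ ∞ (S.χ sg hsg am l δ ham hl hδ hδ8 hl_le hδ_room hδ_up hδ_clean) := by
  unfold χ
  exact (Real.smoothTransition.contDiff.comp (((S.md sg hsg am l δ ham hl hδ hδ8 hl_le hδ_room hδ_up hδ_clean).seg'.contDiff_θhat.sub contDiff_const).div_const _)).mul
    (Real.smoothTransition.contDiff.comp ((contDiff_const.sub (S.md sg hsg am l δ ham hl hδ hδ8 hl_le hδ_room hδ_up hδ_clean).seg'.contDiff_θhat).div_const _))

/-- The window ends of the model: `α = 2πθ₁ - a/16`, `β = 2πθ₁ + a/16`. [folklore] -/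
theorem seg'_αβ : (S.md sg hsg am l δ ham hl hδ hδ8 hl_le hδ_room hδ_up hδ_clean).seg'.α = 2 * π * S.θ₁ - S.a / 16 ∧ (S.md sg hsg am l δ ham hl hδ hδ8 hl_le hδ_room hδ_up hδ_clean).seg'.β = 2 * π * S.θ₁ + S.a / 16 := ⟨rfl, rfl⟩

/-- `χ v = 1` when `θ̂ v ∈ [β + 2gap/3, α + 2π - 2gap/3]`. [folklore] -/
theorem χ_eq_one {v : ℝ} (h1 : (S.md sg hsg am l δ ham hl hδ hδ8 hl_le hδ_room hδ_up hδ_clean).seg'.β + 2 * S.gap / 3 ≤ (S.md sg hsg am l δ ham hl hδ hδ8 hl_le hδ_room hδ_up hδ_clean).seg'.θhat v)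
    (h2 : (S.md sg hsg am l δ ham hl hδ hδ8 hl_le hδ_room hδ_up hδ_clean).seg'.θhat v ≤ (S.md sg hsg am l δ ham hl hδ hδ8 hl_le hδ_room hδ_up hδ_clean).seg'.α + 2 * π - 2 * S.gap / 3) : S.χ sg hsg am l δ ham hl hδ hδ8 hl_le hδ_room hδ_up hδ_clean v = 1 := by
  have hg := S.gap_pos
  rw [χ, Real.smoothTransition.one_of_one_le, Real.smoothTransition.one_of_one_le, mul_one]
  · rw [le_div_iff₀ (by positivity)]; linarith
  · rw [le_div_iff₀ (by positivity)]; linarith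

/-- `χ v = 0` when `θ̂ v ≤ β + gap/3`. [folklore] -/
theorem χ_eq_zero_of_le {v : ℝ} (h : (S.md sg hsg am l δ ham hl hδ hδ8 hl_le hδ_room hδ_up hδ_clean).seg'.θhat v ≤ (S.md sg hsg am l δ ham hl hδ hδ8 hl_le hδ_room hδ_up hδ_clean).seg'.β + S.gap / 3) : S.χ sg hsg am l δ ham hl hδ hδ8 hl_le hδ_room hδ_up hδ_clean v = 0 := by
  have hg := S.gap_pos
  rw [χ, Real.smoothTransition.zero_of_nonpos, zero_mul]
  exact div_nonpos_of_nonpos_of_nonneg (by linarith) (by positivity)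

/-- `χ v = 0` when `α + 2π - gap/3 ≤ θ̂ v`. [folklore] -/
theorem χ_eq_zero_of_ge {v : ℝ} (h : (S.md sg hsg am l δ ham hl hδ hδ8 hl_le hδ_room hδ_up hδ_clean).seg'.α + 2 * π - S.gap / 3 ≤ (S.md sg hsg am l δ ham hl hδ hδ8 hl_le hδ_room hδ_up hδ_clean).seg'.θhat v) : S.χ sg hsg am l δ ham hl hδ hδ8 hl_le hδ_room hδ_up hδ_clean v = 0 := by
  have hg := S.gap_pos
  rw [χ, Real.smoothTransition.zero_of_nonpos (x := ((S.md sg hsg am l δ ham hl hδ hδ8 hl_le hδ_room hδ_up hδ_clean).seg'.α + 2 * π - S.gap / 3 - (S.md sg hsg am l δ ham hl hδ hδ8 hl_le hδ_room hδ_up hδ_clean).seg'.θhat v) / (S.gap / 3)),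
    mul_zero]
  exact div_nonpos_of_nonpos_of_nonneg (by linarith) (by positivity)

/-- **A non-zone middle parameter has `χ = 1`.** [folklore] -/
theorem χ_eq_one_of_not_zone {v : ℝ} (hv : v ∈ Ioc (S.md sg hsg am l δ ham hl hδ hδ8 hl_le hδ_room hδ_up hδ_clean).seg'.uA (S.md sg hsg am l δ ham hl hδ hδ8 hl_le hδ_room hδ_up hδ_clean).seg'.uD) (hz : ¬ S.Zone ((S.md sg hsg am l δ ham hl hδ hδ8 hl_le hδ_room hδ_up hδ_clean).seg'.θhat v)) :
    S.χ sg hsg am l δ ham hl hδ hδ8 hl_le hδ_room hδ_up hδ_clean v = 1 := by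
  have hg := S.gap_pos
  obtain ⟨hα, hβ⟩ := S.seg'_αβ sg hsg am l δ ham hl hδ hδ8 hl_le hδ_room hδ_up hδ_clean
  have hA := (S.md sg hsg am l δ ham hl hδ hδ8 hl_le hδ_room hδ_up hδ_clean).seg'.θA_spec.1
  have hD := (S.md sg hsg am l δ ham hl hδ hδ8 hl_le hδ_room hδ_up hδ_clean).seg'.θD_spec.1
  have hmono := (S.md sg hsg am l δ ham hl hδ hδ8 hl_le hδ_room hδ_up hδ_clean).seg'.strictMono_θhat
  have h1 : (S.md sg hsg am l δ ham hl hδ hδ8 hl_le hδ_room hδ_up hδ_clean).seg'.θA < (S.md sg hsg am l δ ham hl hδ hδ8 hl_le hδ_room hδ_up hδ_clean).seg'.θhat v := by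
    have := hmono hv.1; rwa [(S.md sg hsg am l δ ham hl hδ hδ8 hl_le hδ_room hδ_up hδ_clean).seg'.θhat_of_le (by linarith [(S.md sg hsg am l δ ham hl hδ hδ8 hl_le hδ_room hδ_up hδ_clean).seg'.c₁_pos]), sub_self, mul_zero, add_zero] at this
  have h2 : (S.md sg hsg am l δ ham hl hδ hδ8 hl_le hδ_room hδ_up hδ_clean).seg'.θhat v ≤ (S.md sg hsg am l δ ham hl hδ hδ8 hl_le hδ_room hδ_up hδ_clean).seg'.θD + 2 * π := by
    have := hmono.monotone hv.2
    rwa [(S.md sg hsg am l δ ham hl hδ hδ8 hl_le hδ_room hδ_up hδ_clean).seg'.θhat_of_ge (u := (S.md sg hsg am l δ ham hl hδ hδ8 hl_le hδ_room hδ_up hδ_clean).seg'.uD) (by linarith [(S.md sg hsg am l δ ham hl hδ hδ8 hl_le hδ_room hδ_up hδ_clean).seg'.c₁_pos]), sub_self, mul_zero, add_zero] at this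
  have hmem := S.mem_of_not_zone (by rw [gap] at hg; linarith [hA.1]) (by rw [gap] at hg; linarith [hD.2]) hz
  refine S.χ_eq_one sg hsg am l δ ham hl hδ hδ8 hl_le hδ_room hδ_up hδ_clean ?_ ?_
  · rw [hβ, gap] at *; linarith [hmem.1]
  · rw [hα, gap] at *; linarith [hmem.2]

/-- **Where `χ < 1` on the middle piece, the parameter is in the zone.** [folklore] -/
theorem zone_of_χ_ne_one {v : ℝ} (hv : v ∈ Ioc (S.md sg hsg am l δ ham hl hδ hδ8 hl_le hδ_room hδ_up hδ_clean).seg'.uA (S.md sg hsg am l δ ham hl hδ hδ8 hl_le hδ_room hδ_up hδ_clean).seg'.uD) (hχ : S.χ sg hsg am l δ ham hl hδ hδ8 hl_le hδ_room hδ_up hδ_clean v ≠ 1) :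
    S.Zone ((S.md sg hsg am l δ ham hl hδ hδ8 hl_le hδ_room hδ_up hδ_clean).seg'.θhat v) := by
  by_contra hz
  exact hχ (S.χ_eq_one_of_not_zone sg hsg am l δ ham hl hδ hδ8 hl_le hδ_room hδ_up hδ_clean hv hz)

/-- `χ = 0` off the open middle interval `(uA, uD)`. [folklore] -/
theorem χ_eq_zero_of_not_mem {v : ℝ} (hv : v ∉ Ioo (S.md sg hsg am l δ ham hl hδ hδ8 hl_le hδ_room hδ_up hδ_clean).seg'.uA (S.md sg hsg am l δ ham hl hδ hδ8 hl_le hδ_room hδ_up hδ_clean).seg'.uD) : S.χ sg hsg am l δ ham hl hδ hδ8 hl_le hδ_room hδ_up hδ_clean v = 0 := by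
  have hg := S.gap_pos
  obtain ⟨hα, hβ⟩ := S.seg'_αβ sg hsg am l δ ham hl hδ hδ8 hl_le hδ_room hδ_up hδ_clean
  have hA := (S.md sg hsg am l δ ham hl hδ hδ8 hl_le hδ_room hδ_up hδ_clean).seg'.θA_spec.1
  have hD := (S.md sg hsg am l δ ham hl hδ hδ8 hl_le hδ_room hδ_up hδ_clean).seg'.θD_spec.1
  have hmono := (S.md sg hsg am l δ ham hl hδ hδ8 hl_le hδ_room hδ_up hδ_clean).seg'.strictMono_θhat.monotone
  rw [mem_Ioo, not_and_or, not_lt, not_lt] at hv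
  rcases hv with h | h
  · apply S.χ_eq_zero_of_le sg hsg am l δ ham hl hδ hδ8 hl_le hδ_room hδ_up hδ_clean
    have := hmono h
    rw [(S.md sg hsg am l δ ham hl hδ hδ8 hl_le hδ_room hδ_up hδ_clean).seg'.θhat_of_le (u := (S.md sg hsg am l δ ham hl hδ hδ8 hl_le hδ_room hδ_up hδ_clean).seg'.uA) (by linarith [(S.md sg hsg am l δ ham hl hδ hδ8 hl_le hδ_room hδ_up hδ_clean).seg'.c₁_pos]), sub_self, mul_zero, add_zero] at this
    linarith [hA.2]
  · apply S.χ_eq_zero_of_ge sg hsg am l δ ham hl hδ hδ8 hl_le hδ_room hδ_up hδ_clean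
    have := hmono h
    rw [(S.md sg hsg am l δ ham hl hδ hδ8 hl_le hδ_room hδ_up hδ_clean).seg'.θhat_of_ge (u := (S.md sg hsg am l δ ham hl hδ hδ8 hl_le hδ_room hδ_up hδ_clean).seg'.uD) (by linarith [(S.md sg hsg am l δ ham hl hδ hδ8 hl_le hδ_room hδ_up hδ_clean).seg'.c₁_pos]), sub_self, mul_zero, add_zero] at this
    linarith [hD.1]

/-- The coordinate shuffle `(y, t) ↦ ((y 0, t), (y 1, y 2))`. [folklore] -/
def shuffle (q : 𝔼 3 × ℝ) : (ℝ × ℝ) × (ℝ × ℝ) := ((q.1 0, q.2), (q.1 1, q.1 2))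

/-- The shuffle as a continuous linear map. [folklore] -/
def shuffleL : (𝔼 3 × ℝ) →L[ℝ] (ℝ × ℝ) × (ℝ × ℝ) :=
  (((EuclideanSpace.proj (0 : Fin 3)).comp (ContinuousLinearMap.fst ℝ (𝔼 3) ℝ)).prod
      (ContinuousLinearMap.snd ℝ (𝔼 3) ℝ)).prod
    (((EuclideanSpace.proj (1 : Fin 3)).comp (ContinuousLinearMap.fst ℝ (𝔼 3) ℝ)).prod
      ((EuclideanSpace.proj (2 : Fin 3)).comp (ContinuousLinearMap.fst ℝ (𝔼 3) ℝ)))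

/-- The shuffle is the continuous linear map. [folklore] -/
theorem shuffleL_apply (q : 𝔼 3 × ℝ) : shuffleL q = shuffle q := rfl

/-- The shuffle is injective. [folklore] -/
theorem shuffle_injective : Injective shuffle := by
  intro p q h
  simp only [shuffle, Prod.mk.injEq] at h
  obtain ⟨⟨h0, ht⟩, h1, h2⟩ := h
  refine Prod.ext ?_ ht
  ext i; fin_cases i <;> assumption

/-- The shuffle is `C^∞`. [folklore] -/
theorem contDiff_shuffle : ContDiff ℝ ∞ shuffle := by
  rw [show shuffle = fun q ↦ shuffleL q from funext fun q ↦ (shuffleL_apply q).symm]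
  exact shuffleL.contDiff

variable {η ε : ℝ} (hη1 : η ≤ 1) (hℓη : l * S.ℓ ≤ η / 8) (hρη : 8 * l * (‖S.x₀‖ + 2 * S.a + 1) ≤ η)
  (haε : 2 * am < ε)

include hη1 hℓη hρη haε

/-- The tube fit of the lower piece. [folklore] -/
theorem tubeFit₁ : (S.md sg hsg am l δ ham hl hδ hδ8 hl_le hδ_room hδ_up hδ_clean).piece.TubeFit η ε := (S.md sg hsg am l δ ham hl hδ hδ8 hl_le hδ_room hδ_up hδ_clean).tubeFit hη1 hℓη hρη haε

/-- The tube fit of the upper piece. [folklore] -/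
theorem tubeFit₂' : (S.piece₂ sg hsg am l δ ham hl hδ hδ8 hl_le hδ_room hδ_up hδ_clean).TubeFit η ε := S.tubeFit₂ sg hsg am l δ ham hl hδ hδ8 hl_le hδ_room hδ_up hδ_clean hη1 hℓη hρη haε

/-! ### The correction and the surface -/

/-- The static product detour of the lower piece. [folklore] -/
def c₀ : SurfaceDetour 0 η ε ηD :=
  (KnotPiece.detour (S.tubeFit₁ sg hsg am l δ ham hl hδ hδ8 hl_le hδ_room hδ_up hδ_clean hη1 hℓη hρη haε)).toSurfaceDetour D.η_pos

/-- The static product detour, unfolded. [folklore] -/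
theorem c₀_c (u s : ℝ) : (S.c₀ sg hsg am l δ ham hl hδ hδ8 hl_le hδ_room hδ_up hδ_clean hη1 hℓη hρη haε).c (u, s) = (((S.md sg hsg am l δ ham hl hδ hδ8 hl_le hδ_room hδ_up hδ_clean).piece.κθ u, s), (S.md sg hsg am l δ ham hl hδ hδ8 hl_le hδ_room hδ_up hδ_clean).piece.κd u) := rfl

/-- **The correction** on the fundamental domain: cut-off times (moving picture minus static
detour), over the reduced parameter `v` and the level `s`. [folklore] -/
def corr (s v : ℝ) : (ℝ × ℝ) × (ℝ × ℝ) :=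
  S.χ sg hsg am l δ ham hl hδ hδ8 hl_le hδ_room hδ_up hδ_clean v • (shuffle (S.moving sg hsg am l δ ham hl hδ hδ8 hl_le hδ_room hδ_up hδ_clean ((2 * π)⁻¹ * (S.md sg hsg am l δ ham hl hδ hδ8 hl_le hδ_room hδ_up hδ_clean).seg'.θhat v, s)) - (S.c₀ sg hsg am l δ ham hl hδ hδ8 hl_le hδ_room hδ_up hδ_clean hη1 hℓη hρη haε).c (v, s))

/-- **The two-sided surface**: static product detour plus the periodised correction. [folklore] -/
def surf (p : ℝ × ℝ) : (ℝ × ℝ) × (ℝ × ℝ) :=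
  (S.c₀ sg hsg am l δ ham hl hδ hδ8 hl_le hδ_room hδ_up hδ_clean hη1 hℓη hρη haε).c p + periodise ((S.md sg hsg am l δ ham hl hδ hδ8 hl_le hδ_room hδ_up hδ_clean).chart.θlo - 1 / 2) (S.corr sg hsg am l δ ham hl hδ hδ8 hl_le hδ_room hδ_up hδ_clean hη1 hℓη hρη haε p.2) p.1

/-! ### The correction vanishes off the body -/

/-- The fundamental domain contains the middle interval. [folklore] -/
theorem Ioc_sub_Ico : Ioc (S.md sg hsg am l δ ham hl hδ hδ8 hl_le hδ_room hδ_up hδ_clean).seg'.uA (S.md sg hsg am l δ ham hl hδ hδ8 hl_le hδ_room hδ_up hδ_clean).seg'.uD ⊆ Ico ((S.md sg hsg am l δ ham hl hδ hδ8 hl_le hδ_room hδ_up hδ_clean).chart.θlo - 1 / 2) ((S.md sg hsg am l δ ham hl hδ hδ8 hl_le hδ_room hδ_up hδ_clean).chart.θlo + 1 / 2) := by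
  intro v hv
  have T := S.tubeFit₁ sg hsg am l δ ham hl hδ hδ8 hl_le hδ_room hδ_up hδ_clean hη1 hℓη hρη haε
  have h1 := T.hlo; have h2 := T.hhi
  have hA : (S.md sg hsg am l δ ham hl hδ hδ8 hl_le hδ_room hδ_up hδ_clean).chart.θlo < (S.md sg hsg am l δ ham hl hδ hδ8 hl_le hδ_room hδ_up hδ_clean).seg'.uA := by rw [SegData.uA]; linarith [(S.md sg hsg am l δ ham hl hδ hδ8 hl_le hδ_room hδ_up hδ_clean).seg'.c₁_pos]
  have hD' : (S.md sg hsg am l δ ham hl hδ hδ8 hl_le hδ_room hδ_up hδ_clean).seg'.uD < (S.md sg hsg am l δ ham hl hδ hδ8 hl_le hδ_room hδ_up hδ_clean).chart.θhi := by rw [SegData.uD]; linarith [(S.md sg hsg am l δ ham hl hδ hδ8 hl_le hδ_room hδ_up hδ_clean).seg'.c₁_pos]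
  have := (S.md sg hsg am l δ ham hl hδ hδ8 hl_le hδ_room hδ_up hδ_clean).chart.θlo_lt
  exact ⟨by linarith [hv.1], by linarith [hv.2]⟩

/-- On the middle interval the static detour is the lower piece: `c₀ (v, s) = shuffle (pMid v, s)`. [folklore] -/
theorem c₀_mid {v : ℝ} (hv : v ∈ Ioc (S.md sg hsg am l δ ham hl hδ hδ8 hl_le hδ_room hδ_up hδ_clean).seg'.uA (S.md sg hsg am l δ ham hl hδ hδ8 hl_le hδ_room hδ_up hδ_clean).seg'.uD) (s : ℝ) :
    (S.c₀ sg hsg am l δ ham hl hδ hδ8 hl_le hδ_room hδ_up hδ_clean hη1 hℓη hρη haε).c (v, s) = shuffle ((S.md sg hsg am l δ ham hl hδ hδ8 hl_le hδ_room hδ_up hδ_clean).piece.pMid v, s) := by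
  rw [c₀_c]
  simp only [KnotPiece.κθ, KnotPiece.κd]
  rw [(S.md sg hsg am l δ ham hl hδ hδ8 hl_le hδ_room hδ_up hδ_clean).piece.per_eq_curve (S.Ioc_sub_Ico sg hsg am l δ ham hl hδ hδ8 hl_le hδ_room hδ_up hδ_clean hη1 hℓη hρη haε hv), (S.md sg hsg am l δ ham hl hδ hδ8 hl_le hδ_room hδ_up hδ_clean).piece.curve_of_mem_mid hv]
  rfl

omit hη1 hℓη hρη haε in
/-- **In the zone the moving picture is the middle piece**: `moving (θ̂ v/2π, s) = (pMid v, s)`. [folklore] -/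
theorem moving_of_zone {v : ℝ} (hz : S.Zone ((S.md sg hsg am l δ ham hl hδ hδ8 hl_le hδ_room hδ_up hδ_clean).seg'.θhat v)) (s : ℝ) :
    S.moving sg hsg am l δ ham hl hδ hδ8 hl_le hδ_room hδ_up hδ_clean ((2 * π)⁻¹ * (S.md sg hsg am l δ ham hl hδ hδ8 hl_le hδ_room hδ_up hδ_clean).seg'.θhat v, s) = ((S.md sg hsg am l δ ham hl hδ hδ8 hl_le hδ_room hδ_up hδ_clean).piece.pMid v, s) := by
  rw [S.moving_of_strip sg hsg am l δ ham hl hδ hδ8 hl_le hδ_room hδ_up hδ_clean hz, KnotPiece.pMid, ← mul_assoc, mul_inv_cancel₀ (by positivity), one_mul]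

/-- **The correction vanishes unless the cut-off is `1`.** [folklore] -/
theorem corr_eq (s v : ℝ) : S.corr sg hsg am l δ ham hl hδ hδ8 hl_le hδ_room hδ_up hδ_clean hη1 hℓη hρη haε s v = 0 ∨
    (v ∈ Ioo (S.md sg hsg am l δ ham hl hδ hδ8 hl_le hδ_room hδ_up hδ_clean).seg'.uA (S.md sg hsg am l δ ham hl hδ hδ8 hl_le hδ_room hδ_up hδ_clean).seg'.uD ∧ S.χ sg hsg am l δ ham hl hδ hδ8 hl_le hδ_room hδ_up hδ_clean v = 1 ∧ ¬ S.Zone ((S.md sg hsg am l δ ham hl hδ hδ8 hl_le hδ_room hδ_up hδ_clean).seg'.θhat v) ∧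
      S.corr sg hsg am l δ ham hl hδ hδ8 hl_le hδ_room hδ_up hδ_clean hη1 hℓη hρη haε s v =
        shuffle (S.moving sg hsg am l δ ham hl hδ hδ8 hl_le hδ_room hδ_up hδ_clean ((2 * π)⁻¹ * (S.md sg hsg am l δ ham hl hδ hδ8 hl_le hδ_room hδ_up hδ_clean).seg'.θhat v, s)) - (S.c₀ sg hsg am l δ ham hl hδ hδ8 hl_le hδ_room hδ_up hδ_clean hη1 hℓη hρη haε).c (v, s)) := by
  by_cases hv : v ∈ Ioo (S.md sg hsg am l δ ham hl hδ hδ8 hl_le hδ_room hδ_up hδ_clean).seg'.uA (S.md sg hsg am l δ ham hl hδ hδ8 hl_le hδ_room hδ_up hδ_clean).seg'.uD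
  · by_cases hz : S.Zone ((S.md sg hsg am l δ ham hl hδ hδ8 hl_le hδ_room hδ_up hδ_clean).seg'.θhat v)
    · left
      simp only [corr]
      rw [S.moving_of_zone sg hsg am l δ ham hl hδ hδ8 hl_le hδ_room hδ_up hδ_clean hz, S.c₀_mid sg hsg am l δ ham hl hδ hδ8 hl_le hδ_room hδ_up hδ_clean hη1 hℓη hρη haε ⟨hv.1, hv.2.le⟩, sub_self, smul_zero]
    · right
      have h1 := S.χ_eq_one_of_not_zone sg hsg am l δ ham hl hδ hδ8 hl_le hδ_room hδ_up hδ_clean ⟨hv.1, hv.2.le⟩ hz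
      exact ⟨hv, h1, hz, by simp only [corr]; rw [h1, one_smul]⟩
  · left
    simp only [corr]
    rw [S.χ_eq_zero_of_not_mem sg hsg am l δ ham hl hδ hδ8 hl_le hδ_room hδ_up hδ_clean hv, zero_smul]

/-- The correction vanishes in the zone. [folklore] -/
theorem corr_eq_zero_of_zone {s v : ℝ} (hz : S.Zone ((S.md sg hsg am l δ ham hl hδ hδ8 hl_le hδ_room hδ_up hδ_clean).seg'.θhat v)) : S.corr sg hsg am l δ ham hl hδ hδ8 hl_le hδ_room hδ_up hδ_clean hη1 hℓη hρη haε s v = 0 := by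
  rcases S.corr_eq sg hsg am l δ ham hl hδ hδ8 hl_le hδ_room hδ_up hδ_clean hη1 hℓη hρη haε s v with h | ⟨_, _, hz', _⟩
  · exact h
  · exact (hz' hz).elim

/-- The correction vanishes off the open middle interval. [folklore] -/
theorem corr_eq_zero_of_not_mem {s v : ℝ} (hv : v ∉ Ioo (S.md sg hsg am l δ ham hl hδ hδ8 hl_le hδ_room hδ_up hδ_clean).seg'.uA (S.md sg hsg am l δ ham hl hδ hδ8 hl_le hδ_room hδ_up hδ_clean).seg'.uD) :
    S.corr sg hsg am l δ ham hl hδ hδ8 hl_le hδ_room hδ_up hδ_clean hη1 hℓη hρη haε s v = 0 := by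
  simp only [corr]
  rw [S.χ_eq_zero_of_not_mem sg hsg am l δ ham hl hδ hδ8 hl_le hδ_room hδ_up hδ_clean hv, zero_smul]

/-- The correction is jointly `C^∞`. [folklore] -/
theorem contDiff_corr : ContDiff ℝ ∞ (uncurry (S.corr sg hsg am l δ ham hl hδ hδ8 hl_le hδ_room hδ_up hδ_clean hη1 hℓη hρη haε)) := by
  have h1 : ContDiff ℝ ∞ fun p : ℝ × ℝ ↦ S.χ sg hsg am l δ ham hl hδ hδ8 hl_le hδ_room hδ_up hδ_clean p.2 := (S.contDiff_χ sg hsg am l δ ham hl hδ hδ8 hl_le hδ_room hδ_up hδ_clean).comp contDiff_snd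
  have h2 : ContDiff ℝ ∞ fun p : ℝ × ℝ ↦ shuffle (S.moving sg hsg am l δ ham hl hδ hδ8 hl_le hδ_room hδ_up hδ_clean ((2 * π)⁻¹ * (S.md sg hsg am l δ ham hl hδ hδ8 hl_le hδ_room hδ_up hδ_clean).seg'.θhat p.2, p.1)) :=
    contDiff_shuffle.comp ((S.contDiff_moving sg hsg am l δ ham hl hδ hδ8 hl_le hδ_room hδ_up hδ_clean).comp
      ((contDiff_const.mul ((S.md sg hsg am l δ ham hl hδ hδ8 hl_le hδ_room hδ_up hδ_clean).seg'.contDiff_θhat.comp contDiff_snd)).prodMk contDiff_fst))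
  have h3 : ContDiff ℝ ∞ fun p : ℝ × ℝ ↦ (S.c₀ sg hsg am l δ ham hl hδ hδ8 hl_le hδ_room hδ_up hδ_clean hη1 hℓη hρη haε).c (p.2, p.1) :=
    (S.c₀ sg hsg am l δ ham hl hδ hδ8 hl_le hδ_room hδ_up hδ_clean hη1 hℓη hρη haε).contDiff_c.comp (contDiff_snd.prodMk contDiff_fst)
  exact h1.smul (h2.sub h3)

/-- The seam condition of the correction (it vanishes near both ends of the fundamental domain). [folklore] -/
theorem corr_seam (s : ℝ) (t : ℝ) (ht : t ∈ Ioo ((S.md sg hsg am l δ ham hl hδ hδ8 hl_le hδ_room hδ_up hδ_clean).chart.θlo - 1 / 2 - 1 / 4) ((S.md sg hsg am l δ ham hl hδ hδ8 hl_le hδ_room hδ_up hδ_clean).chart.θlo - 1 / 2 + 1 / 4)) :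
    S.corr sg hsg am l δ ham hl hδ hδ8 hl_le hδ_room hδ_up hδ_clean hη1 hℓη hρη haε s (t + 1) = S.corr sg hsg am l δ ham hl hδ hδ8 hl_le hδ_room hδ_up hδ_clean hη1 hℓη hρη haε s t := by
  have T := S.tubeFit₁ sg hsg am l δ ham hl hδ hδ8 hl_le hδ_room hδ_up hδ_clean hη1 hℓη hρη haε
  have h1 := T.hlo; have h2 := T.hhi
  have hA : (S.md sg hsg am l δ ham hl hδ hδ8 hl_le hδ_room hδ_up hδ_clean).chart.θlo < (S.md sg hsg am l δ ham hl hδ hδ8 hl_le hδ_room hδ_up hδ_clean).seg'.uA := by rw [SegData.uA]; linarith [(S.md sg hsg am l δ ham hl hδ hδ8 hl_le hδ_room hδ_up hδ_clean).seg'.c₁_pos]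
  have hD' : (S.md sg hsg am l δ ham hl hδ hδ8 hl_le hδ_room hδ_up hδ_clean).seg'.uD < (S.md sg hsg am l δ ham hl hδ hδ8 hl_le hδ_room hδ_up hδ_clean).chart.θhi := by rw [SegData.uD]; linarith [(S.md sg hsg am l δ ham hl hδ hδ8 hl_le hδ_room hδ_up hδ_clean).seg'.c₁_pos]
  have hw : (S.md sg hsg am l δ ham hl hδ hδ8 hl_le hδ_room hδ_up hδ_clean).chart.θhi - (S.md sg hsg am l δ ham hl hδ hδ8 hl_le hδ_room hδ_up hδ_clean).chart.θlo ≤ 1 / 16 := by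
    have h := (S.md sg hsg am l δ ham hl hδ hδ8 hl_le hδ_room hδ_up hδ_clean).chart_wid
    rw [ChartData.wid] at h
    have hl' : (S.md sg hsg am l δ ham hl hδ hδ8 hl_le hδ_room hδ_up hδ_clean).l = l := rfl
    have hℓ' : (S.md sg hsg am l δ ham hl hδ hδ8 hl_le hδ_room hδ_up hδ_clean).ℓ = S.ℓ := rfl
    rw [hl', hℓ'] at h
    linarith
  rw [S.corr_eq_zero_of_not_mem sg hsg am l δ ham hl hδ hδ8 hl_le hδ_room hδ_up hδ_clean hη1 hℓη hρη haε (v := t) (fun h ↦ by linarith [h.1, ht.2]),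
    S.corr_eq_zero_of_not_mem sg hsg am l δ ham hl hδ hδ8 hl_le hδ_room hδ_up hδ_clean hη1 hℓη hρη haε (v := t + 1) (fun h ↦ by linarith [h.2, ht.1])]

omit hη1 hℓη hρη haε in
/-- A periodised smooth family is jointly `C^∞`, periodic parameter first (generic form of
`contDiff_periodise_family`). [folklore] -/
theorem _root_.Literature.Topology.FourManifolds.contDiff_periodise_family_swap {X : Type*} [NormedAddCommGroup X]
    [NormedSpace ℝ X] {a ε : ℝ} {F : ℝ → ℝ → X} (hF : ContDiff ℝ ∞ (uncurry F)) (hε : 0 < ε)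
    (hseam : ∀ u, ∀ t ∈ Ioo (a - ε) (a + ε), F u (t + 1) = F u t) :
    ContDiff ℝ ∞ fun p : ℝ × ℝ ↦ periodise a (F p.2) p.1 :=
  (contDiff_periodise_family hF hε hseam).comp (contDiff_snd.prodMk contDiff_fst)

/-- The periodised correction is jointly `C^∞` (periodic parameter first). [folklore] -/
theorem contDiff_periodise_corr :
    ContDiff ℝ ∞ fun p : ℝ × ℝ ↦ periodise ((S.md sg hsg am l δ ham hl hδ hδ8 hl_le hδ_room hδ_up hδ_clean).chart.θlo - 1 / 2) (S.corr sg hsg am l δ ham hl hδ hδ8 hl_le hδ_room hδ_up hδ_clean hη1 hℓη hρη haε p.2) p.1 :=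
  contDiff_periodise_family_swap (S.contDiff_corr sg hsg am l δ ham hl hδ hδ8 hl_le hδ_room hδ_up hδ_clean hη1 hℓη hρη haε) (by norm_num : (0 : ℝ) < 1 / 4)
    (S.corr_seam sg hsg am l δ ham hl hδ hδ8 hl_le hδ_room hδ_up hδ_clean hη1 hℓη hρη haε)

/-- **The surface is `C^∞`.** [folklore] -/
theorem contDiff_surf : ContDiff ℝ ∞ (S.surf sg hsg am l δ ham hl hδ hδ8 hl_le hδ_room hδ_up hδ_clean hη1 hℓη hρη haε) :=
  (S.c₀ sg hsg am l δ ham hl hδ hδ8 hl_le hδ_room hδ_up hδ_clean hη1 hℓη hρη haε).contDiff_c.add (S.contDiff_periodise_corr sg hsg am l δ ham hl hδ hδ8 hl_le hδ_room hδ_up hδ_clean hη1 hℓη hρη haε)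

/-- Integer shifts of the static detour. [folklore] -/
theorem c₀_shift (v s : ℝ) (n : ℤ) : (S.c₀ sg hsg am l δ ham hl hδ hδ8 hl_le hδ_room hδ_up hδ_clean hη1 hℓη hρη haε).c (v + n, s) =
    (S.c₀ sg hsg am l δ ham hl hδ hδ8 hl_le hδ_room hδ_up hδ_clean hη1 hℓη hρη haε).c (v, s) + (((n : ℝ), 0), (0, 0)) := by
  rw [(S.c₀ sg hsg am l δ ham hl hδ hδ8 hl_le hδ_room hδ_up hδ_clean hη1 hℓη hρη haε).c_add_int v s n, c₀_c]
  ext <;> simp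

/-! ### The two values of the surface -/

/-- **The surface is the static detour or the shifted moving body picture.** [folklore] -/
theorem surf_eq (u s : ℝ) : S.surf sg hsg am l δ ham hl hδ hδ8 hl_le hδ_room hδ_up hδ_clean hη1 hℓη hρη haε (u, s) = (S.c₀ sg hsg am l δ ham hl hδ hδ8 hl_le hδ_room hδ_up hδ_clean hη1 hℓη hρη haε).c (u, s) ∨
    ∃ (n : ℤ) (v : ℝ), u = v + n ∧ v ∈ Ioo (S.md sg hsg am l δ ham hl hδ hδ8 hl_le hδ_room hδ_up hδ_clean).seg'.uA (S.md sg hsg am l δ ham hl hδ hδ8 hl_le hδ_room hδ_up hδ_clean).seg'.uD ∧ ¬ S.Zone ((S.md sg hsg am l δ ham hl hδ hδ8 hl_le hδ_room hδ_up hδ_clean).seg'.θhat v) ∧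
      S.surf sg hsg am l δ ham hl hδ hδ8 hl_le hδ_room hδ_up hδ_clean hη1 hℓη hρη haε (u, s) =
        shuffle (S.moving sg hsg am l δ ham hl hδ hδ8 hl_le hδ_room hδ_up hδ_clean ((2 * π)⁻¹ * (S.md sg hsg am l δ ham hl hδ hδ8 hl_le hδ_room hδ_up hδ_clean).seg'.θhat v, s)) + (((n : ℝ), 0), (0, 0)) := by
  obtain ⟨n, hn⟩ := exists_toIcoMod_one_eq ((S.md sg hsg am l δ ham hl hδ hδ8 hl_le hδ_room hδ_up hδ_clean).chart.θlo - 1 / 2) u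
  set v := toIcoMod zero_lt_one ((S.md sg hsg am l δ ham hl hδ hδ8 hl_le hδ_room hδ_up hδ_clean).chart.θlo - 1 / 2) u with hv
  have huv : u = v + n := by rw [hn]; ring
  simp only [surf, periodise]
  rw [← hv]
  rcases S.corr_eq sg hsg am l δ ham hl hδ hδ8 hl_le hδ_room hδ_up hδ_clean hη1 hℓη hρη haε s v with h | ⟨hvI, _, hz, h⟩
  · left; rw [h, add_zero]
  · right
    refine ⟨n, v, huv, hvI, hz, ?_⟩
    rw [h, huv, S.c₀_shift sg hsg am l δ ham hl hδ hδ8 hl_le hδ_room hδ_up hδ_clean hη1 hℓη hρη haε]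
    abel

/-- Outside the body the surface is the static detour (value). [folklore] -/
theorem surf_eq_c₀_of {u s : ℝ} {n : ℤ} (hn : toIcoMod zero_lt_one ((S.md sg hsg am l δ ham hl hδ hδ8 hl_le hδ_room hδ_up hδ_clean).chart.θlo - 1 / 2) u = u - n)
    (h : u - n ∉ Ioo (S.md sg hsg am l δ ham hl hδ hδ8 hl_le hδ_room hδ_up hδ_clean).seg'.uA (S.md sg hsg am l δ ham hl hδ hδ8 hl_le hδ_room hδ_up hδ_clean).seg'.uD ∨ S.Zone ((S.md sg hsg am l δ ham hl hδ hδ8 hl_le hδ_room hδ_up hδ_clean).seg'.θhat (u - n))) :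
    S.surf sg hsg am l δ ham hl hδ hδ8 hl_le hδ_room hδ_up hδ_clean hη1 hℓη hρη haε (u, s) = (S.c₀ sg hsg am l δ ham hl hδ hδ8 hl_le hδ_room hδ_up hδ_clean hη1 hℓη hρη haε).c (u, s) := by
  simp only [surf, periodise]
  rw [hn]
  rcases h with h | h
  · rw [S.corr_eq_zero_of_not_mem sg hsg am l δ ham hl hδ hδ8 hl_le hδ_room hδ_up hδ_clean hη1 hℓη hρη haε h, add_zero]
  · rw [S.corr_eq_zero_of_zone sg hsg am l δ ham hl hδ hδ8 hl_le hδ_room hδ_up hδ_clean hη1 hℓη hρη haε h, add_zero]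

/-! ### Facts for the axioms -/

/-- The middle interval lies in the arc `[-η/8, η/8]`. [folklore] -/
theorem Ioo_sub_arc : Ioo (S.md sg hsg am l δ ham hl hδ hδ8 hl_le hδ_room hδ_up hδ_clean).seg'.uA (S.md sg hsg am l δ ham hl hδ hδ8 hl_le hδ_room hδ_up hδ_clean).seg'.uD ⊆ Icc (-(η / 8)) (η / 8) := by
  intro v hv
  have T := S.tubeFit₁ sg hsg am l δ ham hl hδ hδ8 hl_le hδ_room hδ_up hδ_clean hη1 hℓη hρη haε
  have h1 := T.lo; have h2 := T.hi
  have hA : (S.md sg hsg am l δ ham hl hδ hδ8 hl_le hδ_room hδ_up hδ_clean).chart.θlo < (S.md sg hsg am l δ ham hl hδ hδ8 hl_le hδ_room hδ_up hδ_clean).seg'.uA := by rw [SegData.uA]; linarith [(S.md sg hsg am l δ ham hl hδ hδ8 hl_le hδ_room hδ_up hδ_clean).seg'.c₁_pos]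
  have hD' : (S.md sg hsg am l δ ham hl hδ hδ8 hl_le hδ_room hδ_up hδ_clean).seg'.uD < (S.md sg hsg am l δ ham hl hδ hδ8 hl_le hδ_room hδ_up hδ_clean).chart.θhi := by rw [SegData.uD]; linarith [(S.md sg hsg am l δ ham hl hδ hδ8 hl_le hδ_room hδ_up hδ_clean).seg'.c₁_pos]
  exact ⟨by linarith [hv.1], by linarith [hv.2]⟩

omit hη1 hℓη haε in
/-- `2 l ρ' ≤ η/4`. [folklore] -/
theorem two_l_ρ'_le_eta : 2 * l * (‖S.x₀‖ + 2 * S.a + 1) ≤ η / 4 := by linarith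

omit hη1 hℓη hρη haε in
/-- `2 l ρ' ≤ am/8`. [folklore] -/
theorem two_l_ρ'_le_am : 2 * (S.md sg hsg am l δ ham hl hδ hδ8 hl_le hδ_room hδ_up hδ_clean).l * (S.md sg hsg am l δ ham hl hδ hδ8 hl_le hδ_room hδ_up hδ_clean).ρ' ≤ am / 8 := (S.md sg hsg am l δ ham hl hδ hδ8 hl_le hδ_room hδ_up hδ_clean).two_l_ρ'_le

/-- Unshifting the static detour. [folklore] -/
theorem c₀_unshift (u s : ℝ) (n : ℤ) : (S.c₀ sg hsg am l δ ham hl hδ hδ8 hl_le hδ_room hδ_up hδ_clean hη1 hℓη hρη haε).c (u, s) =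
    (S.c₀ sg hsg am l δ ham hl hδ hδ8 hl_le hδ_room hδ_up hδ_clean hη1 hℓη hρη haε).c (u - n, s) + (((n : ℝ), 0), (0, 0)) := by
  have := S.c₀_shift sg hsg am l δ ham hl hδ hδ8 hl_le hδ_room hδ_up hδ_clean hη1 hℓη hρη haε (u - n) s n
  rwa [sub_add_cancel] at this

/-- On the lower collar the correction has no time component. [folklore] -/
theorem corr_time₁ {s : ℝ} (hs : s ≤ 1 + ηD) (v : ℝ) : (S.corr sg hsg am l δ ham hl hδ hδ8 hl_le hδ_room hδ_up hδ_clean hη1 hℓη hρη haε s v).1.2 = 0 := by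
  simp [corr, moving, shuffle, c₀_c, D.collar₁ _ s hs]

/-- On the upper collar the correction has no time component. [folklore] -/
theorem corr_time₂ {s : ℝ} (hs : 2 - ηD ≤ s) (v : ℝ) : (S.corr sg hsg am l δ ham hl hδ hδ8 hl_le hδ_room hδ_up hδ_clean hη1 hℓη hρη haε s v).1.2 = 0 := by
  simp [corr, moving, shuffle, c₀_c, D.collar₂ _ s hs]

omit hη1 hℓη hρη haε in
/-- A non-zone parameter, in the form consumed by `height_moving_body`. [folklore] -/
theorem forall_of_not_zone {t : ℝ} (hz : ¬ S.Zone t) (m : ℤ) : S.δ₁ ≤ |(2 * π)⁻¹ * t - S.θ₁ - m| := by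
  by_contra h
  exact hz ⟨m, not_le.1 h⟩

omit hη1 hℓη hρη haε in
/-- Zone membership is invariant under integer shifts of the `D`-parameter. [folklore] -/
theorem zone_iff_of_eq {t t' : ℝ} {m : ℤ} (h : (2 * π)⁻¹ * t' = (2 * π)⁻¹ * t + m) : S.Zone t' ↔ S.Zone t := by
  constructor
  · rintro ⟨m', hm'⟩
    refine ⟨m' - m, ?_⟩
    rw [h] at hm'
    push_cast
    rwa [show (2 * π)⁻¹ * t - S.θ₁ - (m' - m) = (2 * π)⁻¹ * t + m - S.θ₁ - m' by ring]
  · rintro ⟨m', hm'⟩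
    refine ⟨m' + m, ?_⟩
    rw [h]
    push_cast
    rwa [show (2 * π)⁻¹ * t + m - S.θ₁ - (m' + m) = (2 * π)⁻¹ * t - S.θ₁ - m' by ring]

/-- **The static detour off the body**: low (height `≤ am`), or the middle piece at a zone
parameter. [folklore] -/
theorem static_cases {u : ℝ} {n : ℤ} (hn : toIcoMod zero_lt_one ((S.md sg hsg am l δ ham hl hδ hδ8 hl_le hδ_room hδ_up hδ_clean).chart.θlo - 1 / 2) u = u - n)
    (h : u - n ∉ Ioo (S.md sg hsg am l δ ham hl hδ hδ8 hl_le hδ_room hδ_up hδ_clean).seg'.uA (S.md sg hsg am l δ ham hl hδ hδ8 hl_le hδ_room hδ_up hδ_clean).seg'.uD ∨ S.Zone ((S.md sg hsg am l δ ham hl hδ hδ8 hl_le hδ_room hδ_up hδ_clean).seg'.θhat (u - n))) (s : ℝ) :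
    ((S.c₀ sg hsg am l δ ham hl hδ hδ8 hl_le hδ_room hδ_up hδ_clean hη1 hℓη hρη haε).c (u, s)).2.1 ≤ am ∨
      (u - n ∈ Ioc (S.md sg hsg am l δ ham hl hδ hδ8 hl_le hδ_room hδ_up hδ_clean).seg'.uA (S.md sg hsg am l δ ham hl hδ hδ8 hl_le hδ_room hδ_up hδ_clean).seg'.uD ∧ S.Zone ((S.md sg hsg am l δ ham hl hδ hδ8 hl_le hδ_room hδ_up hδ_clean).seg'.θhat (u - n)) ∧
        (S.c₀ sg hsg am l δ ham hl hδ hδ8 hl_le hδ_room hδ_up hδ_clean hη1 hℓη hρη haε).c (u, s) = shuffle ((S.md sg hsg am l δ ham hl hδ hδ8 hl_le hδ_room hδ_up hδ_clean).piece.pMid (u - n), s) + (((n : ℝ), 0), (0, 0))) := by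
  have hvmem : u - n ∈ Ico ((S.md sg hsg am l δ ham hl hδ hδ8 hl_le hδ_room hδ_up hδ_clean).chart.θlo - 1 / 2) ((S.md sg hsg am l δ ham hl hδ hδ8 hl_le hδ_room hδ_up hδ_clean).chart.θlo + 1 / 2) := by
    have h := toIcoMod_one_mem ((S.md sg hsg am l δ ham hl hδ hδ8 hl_le hδ_room hδ_up hδ_clean).chart.θlo - 1 / 2) u
    rw [hn] at h
    exact ⟨h.1, by linarith [h.2]⟩
  have hA := (S.md sg hsg am l δ ham hl hδ hδ8 hl_le hδ_room hδ_up hδ_clean).seg'.θA_spec.1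
  have hD := (S.md sg hsg am l δ ham hl hδ hδ8 hl_le hδ_room hδ_up hδ_clean).seg'.θD_spec.1
  obtain ⟨hα, hβ⟩ := S.seg'_αβ sg hsg am l δ ham hl hδ hδ8 hl_le hδ_room hδ_up hδ_clean
  have hg := S.gap_pos
  by_cases hmid : u - n ∈ Ioc (S.md sg hsg am l δ ham hl hδ hδ8 hl_le hδ_room hδ_up hδ_clean).seg'.uA (S.md sg hsg am l δ ham hl hδ hδ8 hl_le hδ_room hδ_up hδ_clean).seg'.uD
  · right
    have hz : S.Zone ((S.md sg hsg am l δ ham hl hδ hδ8 hl_le hδ_room hδ_up hδ_clean).seg'.θhat (u - n)) := by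
      rcases h with h | h
      · -- `u - n = uD`: the end of the middle piece is a window point
        have hvD : u - n = (S.md sg hsg am l δ ham hl hδ hδ8 hl_le hδ_room hδ_up hδ_clean).seg'.uD := le_antisymm hmid.2 (by
          by_contra hlt; exact h ⟨hmid.1, not_le.1 hlt⟩)
        apply S.zone_of_mem₁
        rw [hvD, (S.md sg hsg am l δ ham hl hδ hδ8 hl_le hδ_room hδ_up hδ_clean).seg'.θhat_of_ge (u := (S.md sg hsg am l δ ham hl hδ hδ8 hl_le hδ_room hδ_up hδ_clean).seg'.uD) (by linarith [(S.md sg hsg am l δ ham hl hδ hδ8 hl_le hδ_room hδ_up hδ_clean).seg'.c₁_pos]), sub_self, mul_zero, add_zero]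
        rw [hα, hβ] at hD
        rw [gap] at hg
        exact ⟨by linarith [hD.1], by linarith [hD.2]⟩
      · exact h
    refine ⟨hmid, hz, ?_⟩
    rw [S.c₀_unshift sg hsg am l δ ham hl hδ hδ8 hl_le hδ_room hδ_up hδ_clean hη1 hℓη hρη haε u s n, S.c₀_mid sg hsg am l δ ham hl hδ hδ8 hl_le hδ_room hδ_up hδ_clean hη1 hℓη hρη haε hmid]
  · left
    rw [S.c₀_unshift sg hsg am l δ ham hl hδ hδ8 hl_le hδ_room hδ_up hδ_clean hη1 hℓη hρη haε u s n, c₀_c]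
    simp only [Prod.snd_add, Prod.fst_add, add_zero, KnotPiece.κd]
    rw [(S.md sg hsg am l δ ham hl hδ hδ8 hl_le hδ_room hδ_up hδ_clean).piece.per_eq_curve hvmem]
    rw [mem_Ioc, not_and_or, not_lt, not_le] at hmid
    have ham' : (S.md sg hsg am l δ ham hl hδ hδ8 hl_le hδ_room hδ_up hδ_clean).chart.a = am := rfl
    rcases hmid with h1 | h1
    · rcases le_or_gt (u - n) (S.md sg hsg am l δ ham hl hδ hδ8 hl_le hδ_room hδ_up hδ_clean).chart.θlo with h2 | h2
      · rw [(S.md sg hsg am l δ ham hl hδ hδ8 hl_le hδ_room hδ_up hδ_clean).piece.curve_of_le h2, KnotPiece.core_apply_one]; exact ham.le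
      · have hf := (KnotPiece.pLo_one_facts (C := (S.md sg hsg am l δ ham hl hδ hδ8 hl_le hδ_room hδ_up hδ_clean).chart) (D := (S.md sg hsg am l δ ham hl hδ hδ8 hl_le hδ_room hδ_up hδ_clean).seg') ⟨h2, h1⟩).1.2
        rw [ham'] at hf
        rw [(S.md sg hsg am l δ ham hl hδ hδ8 hl_le hδ_room hδ_up hδ_clean).piece.curve_of_mem_lo ⟨h2, h1⟩]; exact hf
    · rcases le_or_gt (u - n) (S.md sg hsg am l δ ham hl hδ hδ8 hl_le hδ_room hδ_up hδ_clean).chart.θhi with h2 | h2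
      · have hf := (KnotPiece.pUp_one_facts (C := (S.md sg hsg am l δ ham hl hδ hδ8 hl_le hδ_room hδ_up hδ_clean).chart) (D := (S.md sg hsg am l δ ham hl hδ hδ8 hl_le hδ_room hδ_up hδ_clean).seg') ⟨h1, h2⟩).1.2
        rw [ham'] at hf
        rw [(S.md sg hsg am l δ ham hl hδ hδ8 hl_le hδ_room hδ_up hδ_clean).piece.curve_of_mem_up ⟨h1, h2⟩]; exact hf
      · rw [(S.md sg hsg am l δ ham hl hδ hδ8 hl_le hδ_room hδ_up hδ_clean).piece.curve_of_gt h2, KnotPiece.core_apply_one]; exact ham.le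

/-- **The surface on the body**: the shifted moving picture. [folklore] -/
theorem surf_of_body {u : ℝ} {n : ℤ} (hn : toIcoMod zero_lt_one ((S.md sg hsg am l δ ham hl hδ hδ8 hl_le hδ_room hδ_up hδ_clean).chart.θlo - 1 / 2) u = u - n)
    (hvI : u - n ∈ Ioo (S.md sg hsg am l δ ham hl hδ hδ8 hl_le hδ_room hδ_up hδ_clean).seg'.uA (S.md sg hsg am l δ ham hl hδ hδ8 hl_le hδ_room hδ_up hδ_clean).seg'.uD) (hz : ¬ S.Zone ((S.md sg hsg am l δ ham hl hδ hδ8 hl_le hδ_room hδ_up hδ_clean).seg'.θhat (u - n))) (s : ℝ) :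
    S.surf sg hsg am l δ ham hl hδ hδ8 hl_le hδ_room hδ_up hδ_clean hη1 hℓη hρη haε (u, s) =
      shuffle (S.moving sg hsg am l δ ham hl hδ hδ8 hl_le hδ_room hδ_up hδ_clean ((2 * π)⁻¹ * (S.md sg hsg am l δ ham hl hδ hδ8 hl_le hδ_room hδ_up hδ_clean).seg'.θhat (u - n), s)) + (((n : ℝ), 0), (0, 0)) := by
  have h1 := S.χ_eq_one_of_not_zone sg hsg am l δ ham hl hδ hδ8 hl_le hδ_room hδ_up hδ_clean ⟨hvI.1, hvI.2.le⟩ hz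
  have h2 : S.corr sg hsg am l δ ham hl hδ hδ8 hl_le hδ_room hδ_up hδ_clean hη1 hℓη hρη haε s (u - n) =
      shuffle (S.moving sg hsg am l δ ham hl hδ hδ8 hl_le hδ_room hδ_up hδ_clean ((2 * π)⁻¹ * (S.md sg hsg am l δ ham hl hδ hδ8 hl_le hδ_room hδ_up hδ_clean).seg'.θhat (u - n), s)) - (S.c₀ sg hsg am l δ ham hl hδ hδ8 hl_le hδ_room hδ_up hδ_clean hη1 hℓη hρη haε).c (u - n, s) := by
    simp only [corr]; rw [h1, one_smul]
  simp only [surf, periodise]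
  rw [hn, h2, S.c₀_unshift sg hsg am l δ ham hl hδ hδ8 hl_le hδ_room hδ_up hδ_clean hη1 hℓη hρη haε u s n]
  abel

/-- **Distinct values: a moving body point is not a static point.** [folklore] -/
theorem moving_ne_static {u u' s s' : ℝ} {n n' : ℤ} (hs : s ∈ Icc (1 : ℝ) 2) (hs' : s' ∈ Icc (1 : ℝ) 2)
    (hz : ¬ S.Zone ((S.md sg hsg am l δ ham hl hδ hδ8 hl_le hδ_room hδ_up hδ_clean).seg'.θhat (u - n)))
    (hn' : toIcoMod zero_lt_one ((S.md sg hsg am l δ ham hl hδ hδ8 hl_le hδ_room hδ_up hδ_clean).chart.θlo - 1 / 2) u' = u' - n')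
    (h' : u' - n' ∉ Ioo (S.md sg hsg am l δ ham hl hδ hδ8 hl_le hδ_room hδ_up hδ_clean).seg'.uA (S.md sg hsg am l δ ham hl hδ hδ8 hl_le hδ_room hδ_up hδ_clean).seg'.uD ∨ S.Zone ((S.md sg hsg am l δ ham hl hδ hδ8 hl_le hδ_room hδ_up hδ_clean).seg'.θhat (u' - n')))
    (he : shuffle (S.moving sg hsg am l δ ham hl hδ hδ8 hl_le hδ_room hδ_up hδ_clean ((2 * π)⁻¹ * (S.md sg hsg am l δ ham hl hδ hδ8 hl_le hδ_room hδ_up hδ_clean).seg'.θhat (u - n), s)) + (((n : ℝ), 0), (0, 0)) =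
      (S.c₀ sg hsg am l δ ham hl hδ hδ8 hl_le hδ_room hδ_up hδ_clean hη1 hℓη hρη haε).c (u', s')) : False := by
  have hbody := S.height_moving_body sg hsg am l δ ham hl hδ hδ8 hl_le hδ_room hδ_up hδ_clean (S.forall_of_not_zone hz) s
  have hpos : 0 < l * (5 * S.a / 8) := by have := S.a_pos; positivity
  rcases S.static_cases sg hsg am l δ ham hl hδ hδ8 hl_le hδ_room hδ_up hδ_clean hη1 hℓη hρη haε hn' h' s' with hlow | ⟨hmid, hz', heq⟩
  · -- heights
    have h2 := congrArg (fun q : (ℝ × ℝ) × (ℝ × ℝ) ↦ q.2.1) he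
    simp only [Prod.snd_add, Prod.fst_add, add_zero, shuffle] at h2
    linarith
  · -- a strip point of the picture: the annulus is injective
    rw [heq] at he
    -- the shifts agree
    have T := S.tubeFit₁ sg hsg am l δ ham hl hδ hδ8 hl_le hδ_room hδ_up hδ_clean hη1 hℓη hρη haε
    have h0 := congrArg (fun q : (ℝ × ℝ) × (ℝ × ℝ) ↦ q.1.1) he
    simp only [Prod.fst_add, shuffle] at h0
    have hb1 := (S.moving_bounds sg hsg am l δ ham hl hδ hδ8 hl_le hδ_room hδ_up hδ_clean ((2 * π)⁻¹ * (S.md sg hsg am l δ ham hl hδ hδ8 hl_le hδ_room hδ_up hδ_clean).seg'.θhat (u - n), s)).1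
    have hb2 : |(S.md sg hsg am l δ ham hl hδ hδ8 hl_le hδ_room hδ_up hδ_clean).piece.pMid (u' - n') 0| ≤ η / 4 := by
      have := T.kθ ((S.md sg hsg am l δ ham hl hδ hδ8 hl_le hδ_room hδ_up hδ_clean).seg'.θhat (u' - n'))
      rw [KnotPiece.pMid, abs_le]; exact ⟨by linarith [this.1], by linarith [this.2]⟩
    have hρ := S.two_l_ρ'_le_eta l hρη
    have hnn : n = n' := by
      have h1 : |((n : ℝ)) - n'| < 1 := by
        have : (n : ℝ) - n' = (S.md sg hsg am l δ ham hl hδ hδ8 hl_le hδ_room hδ_up hδ_clean).piece.pMid (u' - n') 0 - (S.moving sg hsg am l δ ham hl hδ hδ8 hl_le hδ_room hδ_up hδ_clean ((2 * π)⁻¹ * (S.md sg hsg am l δ ham hl hδ hδ8 hl_le hδ_room hδ_up hδ_clean).seg'.θhat (u - n), s)).1 0 := by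
          linarith
        rw [this]
        calc |(S.md sg hsg am l δ ham hl hδ hδ8 hl_le hδ_room hδ_up hδ_clean).piece.pMid (u' - n') 0 - (S.moving sg hsg am l δ ham hl hδ hδ8 hl_le hδ_room hδ_up hδ_clean ((2 * π)⁻¹ * (S.md sg hsg am l δ ham hl hδ hδ8 hl_le hδ_room hδ_up hδ_clean).seg'.θhat (u - n), s)).1 0|
            ≤ |(S.md sg hsg am l δ ham hl hδ hδ8 hl_le hδ_room hδ_up hδ_clean).piece.pMid (u' - n') 0| + |(S.moving sg hsg am l δ ham hl hδ hδ8 hl_le hδ_room hδ_up hδ_clean ((2 * π)⁻¹ * (S.md sg hsg am l δ ham hl hδ hδ8 hl_le hδ_room hδ_up hδ_clean).seg'.θhat (u - n), s)).1 0| := abs_sub _ _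
          _ < 1 := by linarith
      have : |n - n'| < (1 : ℤ) := by exact_mod_cast h1
      linarith [Int.abs_lt_one_iff.1 this]
    subst hnn
    have he' : shuffle (S.moving sg hsg am l δ ham hl hδ hδ8 hl_le hδ_room hδ_up hδ_clean ((2 * π)⁻¹ * (S.md sg hsg am l δ ham hl hδ hδ8 hl_le hδ_room hδ_up hδ_clean).seg'.θhat (u - n), s)) =
        shuffle ((S.md sg hsg am l δ ham hl hδ hδ8 hl_le hδ_room hδ_up hδ_clean).piece.pMid (u' - n), s') := add_right_cancel he
    have he'' := shuffle_injective he'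
    -- read as positions and times
    have hposeq : (S.moving sg hsg am l δ ham hl hδ hδ8 hl_le hδ_room hδ_up hδ_clean ((2 * π)⁻¹ * (S.md sg hsg am l δ ham hl hδ hδ8 hl_le hδ_room hδ_up hδ_clean).seg'.θhat (u - n), s)).1 = (S.md sg hsg am l δ ham hl hδ hδ8 hl_le hδ_room hδ_up hδ_clean).piece.k (2 * π * ((2 * π)⁻¹ * (S.md sg hsg am l δ ham hl hδ hδ8 hl_le hδ_room hδ_up hδ_clean).seg'.θhat (u' - n))) := by
      rw [← mul_assoc, mul_inv_cancel₀ (by positivity), one_mul]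
      exact congrArg Prod.fst he''
    have htime : (S.moving sg hsg am l δ ham hl hδ hδ8 hl_le hδ_room hδ_up hδ_clean ((2 * π)⁻¹ * (S.md sg hsg am l δ ham hl hδ hδ8 hl_le hδ_room hδ_up hδ_clean).seg'.θhat (u - n), s)).2 = s' := congrArg Prod.snd he''
    have hF := S.F_eq_of_moving_eq_strip sg hsg am l δ ham hl hδ hδ8 hl_le hδ_room hδ_up hδ_clean hz' hposeq htime
    obtain ⟨-, m, hm⟩ := D.inj ((2 * π)⁻¹ * (S.md sg hsg am l δ ham hl hδ hδ8 hl_le hδ_room hδ_up hδ_clean).seg'.θhat (u - n), s) ((2 * π)⁻¹ * (S.md sg hsg am l δ ham hl hδ hδ8 hl_le hδ_room hδ_up hδ_clean).seg'.θhat (u' - n), s') hs hs' hF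
    simp only at hm
    exact hz ((S.zone_iff_of_eq hm).1 hz')

omit hℓη haε in
/-- **Distinct parameters of equal moving body values** differ by the shift only. [folklore] -/
theorem eq_of_moving_eq {u u' s s' : ℝ} {n n' : ℤ} (hs : s ∈ Icc (1 : ℝ) 2) (hs' : s' ∈ Icc (1 : ℝ) 2)
    (hvI : u - n ∈ Ioo (S.md sg hsg am l δ ham hl hδ hδ8 hl_le hδ_room hδ_up hδ_clean).seg'.uA (S.md sg hsg am l δ ham hl hδ hδ8 hl_le hδ_room hδ_up hδ_clean).seg'.uD) (hvI' : u' - n' ∈ Ioo (S.md sg hsg am l δ ham hl hδ hδ8 hl_le hδ_room hδ_up hδ_clean).seg'.uA (S.md sg hsg am l δ ham hl hδ hδ8 hl_le hδ_room hδ_up hδ_clean).seg'.uD)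
    (he : shuffle (S.moving sg hsg am l δ ham hl hδ hδ8 hl_le hδ_room hδ_up hδ_clean ((2 * π)⁻¹ * (S.md sg hsg am l δ ham hl hδ hδ8 hl_le hδ_room hδ_up hδ_clean).seg'.θhat (u - n), s)) + (((n : ℝ), 0), (0, 0)) =
      shuffle (S.moving sg hsg am l δ ham hl hδ hδ8 hl_le hδ_room hδ_up hδ_clean ((2 * π)⁻¹ * (S.md sg hsg am l δ ham hl hδ hδ8 hl_le hδ_room hδ_up hδ_clean).seg'.θhat (u' - n'), s')) + (((n' : ℝ), 0), (0, 0))) :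
    s = s' ∧ u' = u + ((n' - n : ℤ) : ℝ) := by
  have hρ := S.two_l_ρ'_le_eta l hρη
  have hb1 := (S.moving_bounds sg hsg am l δ ham hl hδ hδ8 hl_le hδ_room hδ_up hδ_clean ((2 * π)⁻¹ * (S.md sg hsg am l δ ham hl hδ hδ8 hl_le hδ_room hδ_up hδ_clean).seg'.θhat (u - n), s)).1
  have hb2 := (S.moving_bounds sg hsg am l δ ham hl hδ hδ8 hl_le hδ_room hδ_up hδ_clean ((2 * π)⁻¹ * (S.md sg hsg am l δ ham hl hδ hδ8 hl_le hδ_room hδ_up hδ_clean).seg'.θhat (u' - n'), s')).1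
  have h0 := congrArg (fun q : (ℝ × ℝ) × (ℝ × ℝ) ↦ q.1.1) he
  simp only [Prod.fst_add, shuffle] at h0
  have hnn : n = n' := by
    have h1 : |((n : ℝ)) - n'| < 1 := by
      have : (n : ℝ) - n' = (S.moving sg hsg am l δ ham hl hδ hδ8 hl_le hδ_room hδ_up hδ_clean ((2 * π)⁻¹ * (S.md sg hsg am l δ ham hl hδ hδ8 hl_le hδ_room hδ_up hδ_clean).seg'.θhat (u' - n'), s')).1 0 -
          (S.moving sg hsg am l δ ham hl hδ hδ8 hl_le hδ_room hδ_up hδ_clean ((2 * π)⁻¹ * (S.md sg hsg am l δ ham hl hδ hδ8 hl_le hδ_room hδ_up hδ_clean).seg'.θhat (u - n), s)).1 0 := by linarith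
      rw [this]
      calc _ ≤ |(S.moving sg hsg am l δ ham hl hδ hδ8 hl_le hδ_room hδ_up hδ_clean ((2 * π)⁻¹ * (S.md sg hsg am l δ ham hl hδ hδ8 hl_le hδ_room hδ_up hδ_clean).seg'.θhat (u' - n'), s')).1 0| +
            |(S.moving sg hsg am l δ ham hl hδ hδ8 hl_le hδ_room hδ_up hδ_clean ((2 * π)⁻¹ * (S.md sg hsg am l δ ham hl hδ hδ8 hl_le hδ_room hδ_up hδ_clean).seg'.θhat (u - n), s)).1 0| := abs_sub _ _
        _ < 1 := by linarith
    have : |n - n'| < (1 : ℤ) := by exact_mod_cast h1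
    linarith [Int.abs_lt_one_iff.1 this]
  subst hnn
  have he' := shuffle_injective (add_right_cancel he)
  obtain ⟨hss, m, hm⟩ := S.moving_inj sg hsg am l δ ham hl hδ hδ8 hl_le hδ_room hδ_up hδ_clean (p := (_, s)) (q := (_, s')) hs hs' he'
  simp only at hss hm
  refine ⟨hss, ?_⟩
  -- `θ̂ (u' - n) = θ̂ (u - n) + 2π m` inside an interval shorter than `2π`: `m = 0`
  have hθ : (S.md sg hsg am l δ ham hl hδ hδ8 hl_le hδ_room hδ_up hδ_clean).seg'.θhat (u' - n) = (S.md sg hsg am l δ ham hl hδ hδ8 hl_le hδ_room hδ_up hδ_clean).seg'.θhat (u - n) + 2 * π * m := by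
    have := congrArg (fun x : ℝ ↦ 2 * π * x) hm
    simp only [mul_add, ← mul_assoc, mul_inv_cancel₀ (by positivity : (2 * π : ℝ) ≠ 0), one_mul] at this
    linarith
  have hmono := (S.md sg hsg am l δ ham hl hδ hδ8 hl_le hδ_room hδ_up hδ_clean).seg'.strictMono_θhat
  have hrange : ∀ {v : ℝ}, v ∈ Ioo (S.md sg hsg am l δ ham hl hδ hδ8 hl_le hδ_room hδ_up hδ_clean).seg'.uA (S.md sg hsg am l δ ham hl hδ hδ8 hl_le hδ_room hδ_up hδ_clean).seg'.uD →
      (S.md sg hsg am l δ ham hl hδ hδ8 hl_le hδ_room hδ_up hδ_clean).seg'.θhat v ∈ Ioo (S.md sg hsg am l δ ham hl hδ hδ8 hl_le hδ_room hδ_up hδ_clean).seg'.θA ((S.md sg hsg am l δ ham hl hδ hδ8 hl_le hδ_room hδ_up hδ_clean).seg'.θD + 2 * π) := by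
    intro v hv
    constructor
    · have := hmono hv.1
      rwa [(S.md sg hsg am l δ ham hl hδ hδ8 hl_le hδ_room hδ_up hδ_clean).seg'.θhat_of_le (u := (S.md sg hsg am l δ ham hl hδ hδ8 hl_le hδ_room hδ_up hδ_clean).seg'.uA) (by linarith [(S.md sg hsg am l δ ham hl hδ hδ8 hl_le hδ_room hδ_up hδ_clean).seg'.c₁_pos]), sub_self, mul_zero, add_zero] at this
    · have := hmono hv.2
      rwa [(S.md sg hsg am l δ ham hl hδ hδ8 hl_le hδ_room hδ_up hδ_clean).seg'.θhat_of_ge (u := (S.md sg hsg am l δ ham hl hδ hδ8 hl_le hδ_room hδ_up hδ_clean).seg'.uD) (by linarith [(S.md sg hsg am l δ ham hl hδ hδ8 hl_le hδ_room hδ_up hδ_clean).seg'.c₁_pos]), sub_self, mul_zero, add_zero] at this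
  have h1 := hrange hvI
  have h2 := hrange hvI'
  have hLt := (S.md sg hsg am l δ ham hl hδ hδ8 hl_le hδ_room hδ_up hδ_clean).seg'.θD_lt_θA
  have hm0 : m = 0 := by
    have hlt : |(m : ℝ)| < 1 := by
      rw [abs_lt]; constructor <;> nlinarith [h1.1, h1.2, h2.1, h2.2, Real.pi_gt_three]
    have : |m| < (1 : ℤ) := by exact_mod_cast hlt
    exact Int.abs_lt_one_iff.1 this
  rw [hm0, Int.cast_zero, mul_zero, add_zero] at hθ
  have hvv : u' - n = u - n := hmono.injective hθ
  push_cast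
  linarith

/-! ### The surface is an immersion -/

omit hη1 hℓη hρη haε in
/-- The map `(x, t) ↦ (T (Ψ x), t)` has injective differential off the centre. [folklore] -/
theorem injective_fderiv_TΨ {x : 𝔼 3} (hx : x ≠ ctr S.x₀ S.a) (t : ℝ) :
    ∃ L : (𝔼 3 × ℝ) →L[ℝ] (𝔼 3 × ℝ), HasFDerivAt (fun q : 𝔼 3 × ℝ ↦ ((S.md sg hsg am l δ ham hl hδ hδ8 hl_le hδ_room hδ_up hδ_clean).T (S.Ψ q.1), q.2)) L (x, t) ∧ Injective L := by
  obtain ⟨hφ, -, -, hw₂, hsupp, -⟩ := S.φ_facts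
  have hΨd : DifferentiableAt ℝ S.Ψ x := (contDiffAt_Ψ hφ hw₂ hsupp hx).differentiableAt (by simp)
  have hΨ : HasFDerivAt S.Ψ (fderiv ℝ S.Ψ x) x := hΨd.hasFDerivAt
  have hT := Knot.IsConicalConcordance.hasFDerivAt_affT (S.md sg hsg am l δ ham hl hδ hδ8 hl_le hδ_room hδ_up hδ_clean).x₀ (S.md sg hsg am l δ ham hl hδ hδ8 hl_le hδ_room hδ_up hδ_clean).p (S.md sg hsg am l δ ham hl hδ hδ8 hl_le hδ_room hδ_up hδ_clean).M (S.md sg hsg am l δ ham hl hδ hδ8 hl_le hδ_room hδ_up hδ_clean).l (S.Ψ x)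
  have hcomp : HasFDerivAt (fun q : 𝔼 3 × ℝ ↦ (S.md sg hsg am l δ ham hl hδ hδ8 hl_le hδ_room hδ_up hδ_clean).T (S.Ψ q.1))
      (((S.md sg hsg am l δ ham hl hδ hδ8 hl_le hδ_room hδ_up hδ_clean).l • ((S.md sg hsg am l δ ham hl hδ hδ8 hl_le hδ_room hδ_up hδ_clean).M : 𝔼 3 →L[ℝ] 𝔼 3)).comp ((fderiv ℝ S.Ψ x).comp (ContinuousLinearMap.fst ℝ (𝔼 3) ℝ))) (x, t) := by
    have h1 : HasFDerivAt (fun q : 𝔼 3 × ℝ ↦ S.Ψ q.1) ((fderiv ℝ S.Ψ x).comp (ContinuousLinearMap.fst ℝ (𝔼 3) ℝ)) (x, t) :=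
      hΨ.comp (x, t) hasFDerivAt_fst
    exact hT.comp (x, t) h1
  refine ⟨_, hcomp.prodMk hasFDerivAt_snd, ?_⟩
  intro v w hvw
  simp only [ContinuousLinearMap.prod_apply, Prod.mk.injEq, ContinuousLinearMap.coe_comp, comp_apply,
    ContinuousLinearMap.coe_fst', ContinuousLinearMap.coe_snd'] at hvw
  obtain ⟨h1, h2⟩ := hvw
  refine Prod.ext ?_ h2
  have hinjΨ := injective_fderiv_Ψ (x₀ := S.x₀) S.e_two S.a_pos.ne' hφ hw₂ hsupp hx
  have h1' : (S.md sg hsg am l δ ham hl hδ hδ8 hl_le hδ_room hδ_up hδ_clean).l • (S.md sg hsg am l δ ham hl hδ hδ8 hl_le hδ_room hδ_up hδ_clean).M (fderiv ℝ S.Ψ x v.1) = (S.md sg hsg am l δ ham hl hδ hδ8 hl_le hδ_room hδ_up hδ_clean).l • (S.md sg hsg am l δ ham hl hδ hδ8 hl_le hδ_room hδ_up hδ_clean).M (fderiv ℝ S.Ψ x w.1) := h1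
  exact hinjΨ ((S.md sg hsg am l δ ham hl hδ hδ8 hl_le hδ_room hδ_up hδ_clean).M.injective (smul_right_injective _ (S.md sg hsg am l δ ham hl hδ hδ8 hl_le hδ_room hδ_up hδ_clean).l_pos.ne' h1'))

omit hη1 hℓη hρη haε in
/-- **The moving picture is an immersion** over levels in `[1, 2]`. [folklore] -/
theorem injective_fderiv_moving {θ s : ℝ} (hs : s ∈ Icc (1 : ℝ) 2) :
    Injective (fderiv ℝ (S.moving sg hsg am l δ ham hl hδ hδ8 hl_le hδ_room hδ_up hδ_clean) (θ, s)) := by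
  obtain ⟨L, hL, hLinj⟩ := S.injective_fderiv_TΨ sg hsg am l δ ham hl hδ hδ8 hl_le hδ_room hδ_up hδ_clean (S.pos_ne_ctr θ s) (D.F (θ, s)).2
  have hF : HasFDerivAt D.F (fderiv ℝ D.F (θ, s)) (θ, s) := ((D.contDiff_F.differentiable (by simp)) _).hasFDerivAt
  have hfun : S.moving sg hsg am l δ ham hl hδ hδ8 hl_le hδ_room hδ_up hδ_clean = (fun q : 𝔼 3 × ℝ ↦ ((S.md sg hsg am l δ ham hl hδ hδ8 hl_le hδ_room hδ_up hδ_clean).T (S.Ψ q.1), q.2)) ∘ D.F := rfl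
  rw [hfun, (hL.comp (θ, s) hF).fderiv, ContinuousLinearMap.coe_comp]
  exact hLinj.comp (D.injective_fderiv (θ, s) hs)

omit hη1 hℓη hρη haε in
/-- The shifted moving body picture `q ↦ shuffle (moving (θ̂ (q.1 - n) / 2π, q.2)) + const` is an
immersion over levels in `[1, 2]`. [folklore] -/
theorem injective_fderiv_movingBody (n : ℤ) (K : (ℝ × ℝ) × (ℝ × ℝ)) {u s : ℝ} (hs : s ∈ Icc (1 : ℝ) 2) :
    Injective (fderiv ℝ (fun q : ℝ × ℝ ↦
      shuffle (S.moving sg hsg am l δ ham hl hδ hδ8 hl_le hδ_room hδ_up hδ_clean ((2 * π)⁻¹ * (S.md sg hsg am l δ ham hl hδ hδ8 hl_le hδ_room hδ_up hδ_clean).seg'.θhat (q.1 - n), q.2)) + K) (u, s)) := by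
  -- the inner reparametrisation
  set g : ℝ × ℝ → ℝ × ℝ := fun q ↦ ((2 * π)⁻¹ * (S.md sg hsg am l δ ham hl hδ hδ8 hl_le hδ_room hδ_up hδ_clean).seg'.θhat (q.1 - n), q.2) with hg
  have hθd : HasDerivAt (fun v : ℝ ↦ (2 * π)⁻¹ * (S.md sg hsg am l δ ham hl hδ hδ8 hl_le hδ_room hδ_up hδ_clean).seg'.θhat (v - n))
      ((2 * π)⁻¹ * deriv (S.md sg hsg am l δ ham hl hδ hδ8 hl_le hδ_room hδ_up hδ_clean).seg'.θhat (u - n)) u := by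
    have h1 : HasDerivAt (S.md sg hsg am l δ ham hl hδ hδ8 hl_le hδ_room hδ_up hδ_clean).seg'.θhat (deriv (S.md sg hsg am l δ ham hl hδ hδ8 hl_le hδ_room hδ_up hδ_clean).seg'.θhat (u - n)) (u - n) :=
      (((S.md sg hsg am l δ ham hl hδ hδ8 hl_le hδ_room hδ_up hδ_clean).seg'.contDiff_θhat.differentiable (by simp)) _).hasDerivAt
    have h2 := h1.comp_sub_const u (n : ℝ)
    exact h2.const_mul _
  set Jg : ℝ × ℝ →L[ℝ] ℝ × ℝ :=
    ((ContinuousLinearMap.toSpanSingleton ℝ ((2 * π)⁻¹ * deriv (S.md sg hsg am l δ ham hl hδ hδ8 hl_le hδ_room hδ_up hδ_clean).seg'.θhat (u - n))).comp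
      (ContinuousLinearMap.fst ℝ ℝ ℝ)).prod (ContinuousLinearMap.snd ℝ ℝ ℝ) with hJg
  have hgd : HasFDerivAt g Jg (u, s) := by
    have h1 : HasFDerivAt (fun q : ℝ × ℝ ↦ (2 * π)⁻¹ * (S.md sg hsg am l δ ham hl hδ hδ8 hl_le hδ_room hδ_up hδ_clean).seg'.θhat (q.1 - n))
        ((ContinuousLinearMap.toSpanSingleton ℝ ((2 * π)⁻¹ * deriv (S.md sg hsg am l δ ham hl hδ hδ8 hl_le hδ_room hδ_up hδ_clean).seg'.θhat (u - n))).comp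
          (ContinuousLinearMap.fst ℝ ℝ ℝ)) (u, s) :=
      HasFDerivAt.comp (u, s) (g := fun v : ℝ ↦ (2 * π)⁻¹ * (S.md sg hsg am l δ ham hl hδ hδ8 hl_le hδ_room hδ_up hδ_clean).seg'.θhat (v - n)) (f := Prod.fst)
        hθd.hasFDerivAt (hasFDerivAt_fst (𝕜 := ℝ) (E := ℝ) (F := ℝ))
    exact h1.prodMk hasFDerivAt_snd
  have hJg_inj : Injective Jg := by
    intro v w hvw
    simp only [hJg, ContinuousLinearMap.prod_apply, Prod.mk.injEq, ContinuousLinearMap.coe_comp, comp_apply,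
      ContinuousLinearMap.coe_fst', ContinuousLinearMap.coe_snd', ContinuousLinearMap.toSpanSingleton_apply,
      smul_eq_mul] at hvw
    obtain ⟨h1, h2⟩ := hvw
    have hc : (2 * π)⁻¹ * deriv (S.md sg hsg am l δ ham hl hδ hδ8 hl_le hδ_room hδ_up hδ_clean).seg'.θhat (u - n) ≠ 0 :=
      mul_ne_zero (by positivity) ((S.md sg hsg am l δ ham hl hδ hδ8 hl_le hδ_room hδ_up hδ_clean).seg'.deriv_θhat_pos _).ne'
    exact Prod.ext (mul_right_cancel₀ hc h1) h2
  -- the moving picture at `g (u, s)`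
  have hM : HasFDerivAt (S.moving sg hsg am l δ ham hl hδ hδ8 hl_le hδ_room hδ_up hδ_clean) (fderiv ℝ (S.moving sg hsg am l δ ham hl hδ hδ8 hl_le hδ_room hδ_up hδ_clean) (g (u, s))) (g (u, s)) :=
    (((S.contDiff_moving sg hsg am l δ ham hl hδ hδ8 hl_le hδ_room hδ_up hδ_clean).differentiable (by simp)) _).hasFDerivAt
  have hMinj : Injective (fderiv ℝ (S.moving sg hsg am l δ ham hl hδ hδ8 hl_le hδ_room hδ_up hδ_clean) (g (u, s))) := S.injective_fderiv_moving sg hsg am l δ ham hl hδ hδ8 hl_le hδ_room hδ_up hδ_clean hs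
  -- assemble
  have htot : HasFDerivAt (fun q : ℝ × ℝ ↦ shuffle (S.moving sg hsg am l δ ham hl hδ hδ8 hl_le hδ_room hδ_up hδ_clean (g q)) + K)
      (shuffleL.comp ((fderiv ℝ (S.moving sg hsg am l δ ham hl hδ hδ8 hl_le hδ_room hδ_up hδ_clean) (g (u, s))).comp Jg)) (u, s) := by
    have h1 := (hM.comp (u, s) hgd)
    have h2 : HasFDerivAt shuffle shuffleL (S.moving sg hsg am l δ ham hl hδ hδ8 hl_le hδ_room hδ_up hδ_clean (g (u, s))) := by
      rw [show shuffle = fun q ↦ shuffleL q from funext fun q ↦ (shuffleL_apply q).symm]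
      exact shuffleL.hasFDerivAt
    exact (h2.comp (u, s) h1).add_const K
  rw [htot.fderiv, ContinuousLinearMap.coe_comp, ContinuousLinearMap.coe_comp]
  have hsh : Injective shuffleL := fun a b h ↦ shuffle_injective (by rwa [shuffleL_apply, shuffleL_apply] at h)
  exact hsh.comp (hMinj.comp hJg_inj)

omit hη1 hℓη hρη haε in
/-- The zone is an open condition. [folklore] -/
theorem isOpen_zone : IsOpen {t : ℝ | S.Zone t} := by
  have : {t : ℝ | S.Zone t} = ⋃ m : ℤ, (fun t : ℝ ↦ (2 * π)⁻¹ * t - S.θ₁ - m) ⁻¹' Metric.ball 0 S.δ₁ := by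
    ext t
    simp only [Zone, mem_setOf_eq, mem_iUnion, mem_preimage, Metric.mem_ball, dist_zero_right, Real.norm_eq_abs]
  rw [this]
  exact isOpen_iUnion fun m ↦ (continuous_const.mul continuous_id |>.sub continuous_const |>.sub continuous_const).isOpen_preimage _ Metric.isOpen_ball

/-- **Off the body the correction vanishes on a neighbourhood criterion**: if `v < uA`, `uD < v`
or `θ̂ v` is in the zone, then `corr s v = 0`. [folklore] -/
theorem corr_eq_zero_of_crit {s v : ℝ} (h : v < (S.md sg hsg am l δ ham hl hδ hδ8 hl_le hδ_room hδ_up hδ_clean).seg'.uA ∨ (S.md sg hsg am l δ ham hl hδ hδ8 hl_le hδ_room hδ_up hδ_clean).seg'.uD < v ∨ S.Zone ((S.md sg hsg am l δ ham hl hδ hδ8 hl_le hδ_room hδ_up hδ_clean).seg'.θhat v)) :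
    S.corr sg hsg am l δ ham hl hδ hδ8 hl_le hδ_room hδ_up hδ_clean hη1 hℓη hρη haε s v = 0 := by
  rcases h with h | h | h
  · exact S.corr_eq_zero_of_not_mem sg hsg am l δ ham hl hδ hδ8 hl_le hδ_room hδ_up hδ_clean hη1 hℓη hρη haε fun hh ↦ by linarith [hh.1]
  · exact S.corr_eq_zero_of_not_mem sg hsg am l δ ham hl hδ hδ8 hl_le hδ_room hδ_up hδ_clean hη1 hℓη hρη haε fun hh ↦ by linarith [hh.2]
  · exact S.corr_eq_zero_of_zone sg hsg am l δ ham hl hδ hδ8 hl_le hδ_room hδ_up hδ_clean hη1 hℓη hρη haε h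

omit hη1 hℓη hρη haε in
/-- The criterion holds at every non-body reduced parameter. [folklore] -/
theorem crit_of_not_body {v : ℝ} (h : ¬ (v ∈ Ioo (S.md sg hsg am l δ ham hl hδ hδ8 hl_le hδ_room hδ_up hδ_clean).seg'.uA (S.md sg hsg am l δ ham hl hδ hδ8 hl_le hδ_room hδ_up hδ_clean).seg'.uD ∧ ¬ S.Zone ((S.md sg hsg am l δ ham hl hδ hδ8 hl_le hδ_room hδ_up hδ_clean).seg'.θhat v))) :
    v < (S.md sg hsg am l δ ham hl hδ hδ8 hl_le hδ_room hδ_up hδ_clean).seg'.uA ∨ (S.md sg hsg am l δ ham hl hδ hδ8 hl_le hδ_room hδ_up hδ_clean).seg'.uD < v ∨ S.Zone ((S.md sg hsg am l δ ham hl hδ hδ8 hl_le hδ_room hδ_up hδ_clean).seg'.θhat v) := by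
  obtain ⟨hα, hβ⟩ := S.seg'_αβ sg hsg am l δ ham hl hδ hδ8 hl_le hδ_room hδ_up hδ_clean
  have hA := (S.md sg hsg am l δ ham hl hδ hδ8 hl_le hδ_room hδ_up hδ_clean).seg'.θA_spec.1
  have hD := (S.md sg hsg am l δ ham hl hδ hδ8 hl_le hδ_room hδ_up hδ_clean).seg'.θD_spec.1
  have hg := S.gap_pos
  rw [gap] at hg
  rw [hα, hβ] at hA hD
  rcases lt_trichotomy v (S.md sg hsg am l δ ham hl hδ hδ8 hl_le hδ_room hδ_up hδ_clean).seg'.uA with h1 | h1 | h1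
  · exact Or.inl h1
  · right; right
    rw [h1, (S.md sg hsg am l δ ham hl hδ hδ8 hl_le hδ_room hδ_up hδ_clean).seg'.θhat_of_le (u := (S.md sg hsg am l δ ham hl hδ hδ8 hl_le hδ_room hδ_up hδ_clean).seg'.uA) (by linarith [(S.md sg hsg am l δ ham hl hδ hδ8 hl_le hδ_room hδ_up hδ_clean).seg'.c₁_pos]), sub_self, mul_zero, add_zero]
    exact S.zone_of_mem₀ ⟨by linarith [hA.1], by linarith [hA.2]⟩
  rcases lt_trichotomy v (S.md sg hsg am l δ ham hl hδ hδ8 hl_le hδ_room hδ_up hδ_clean).seg'.uD with h2 | h2 | h2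
  · right; right
    by_contra hz
    exact h ⟨⟨h1, h2⟩, hz⟩
  · right; right
    rw [h2, (S.md sg hsg am l δ ham hl hδ hδ8 hl_le hδ_room hδ_up hδ_clean).seg'.θhat_of_ge (u := (S.md sg hsg am l δ ham hl hδ hδ8 hl_le hδ_room hδ_up hδ_clean).seg'.uD) (by linarith [(S.md sg hsg am l δ ham hl hδ hδ8 hl_le hδ_room hδ_up hδ_clean).seg'.c₁_pos]), sub_self, mul_zero, add_zero]
    exact S.zone_of_mem₁ ⟨by linarith [hD.1], by linarith [hD.2]⟩
  · exact Or.inr (Or.inl h2)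

omit hη1 hℓη hρη haε in
/-- The criterion is an open condition. [folklore] -/
theorem isOpen_crit : IsOpen {v : ℝ | v < (S.md sg hsg am l δ ham hl hδ hδ8 hl_le hδ_room hδ_up hδ_clean).seg'.uA ∨ (S.md sg hsg am l δ ham hl hδ hδ8 hl_le hδ_room hδ_up hδ_clean).seg'.uD < v ∨ S.Zone ((S.md sg hsg am l δ ham hl hδ hδ8 hl_le hδ_room hδ_up hδ_clean).seg'.θhat v)} := by
  have h1 : IsOpen {v : ℝ | v < (S.md sg hsg am l δ ham hl hδ hδ8 hl_le hδ_room hδ_up hδ_clean).seg'.uA} := isOpen_lt continuous_id continuous_const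
  have h2 : IsOpen {v : ℝ | (S.md sg hsg am l δ ham hl hδ hδ8 hl_le hδ_room hδ_up hδ_clean).seg'.uD < v} := isOpen_lt continuous_const continuous_id
  have h3 : IsOpen {v : ℝ | S.Zone ((S.md sg hsg am l δ ham hl hδ hδ8 hl_le hδ_room hδ_up hδ_clean).seg'.θhat v)} := S.isOpen_zone.preimage (S.md sg hsg am l δ ham hl hδ hδ8 hl_le hδ_room hδ_up hδ_clean).seg'.contDiff_θhat.continuous
  exact (h1.union (h2.union h3))

/-- **The local form of the surface.** Near `(u, s)` the surface is `c₀ q + corr q.2 (q.1 - n)` for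
the integer `n` of the reduction of `u`. [folklore] -/
theorem surf_eventuallyEq (u s : ℝ) : ∃ n : ℤ, toIcoMod zero_lt_one ((S.md sg hsg am l δ ham hl hδ hδ8 hl_le hδ_room hδ_up hδ_clean).chart.θlo - 1 / 2) u = u - n ∧
    S.surf sg hsg am l δ ham hl hδ hδ8 hl_le hδ_room hδ_up hδ_clean hη1 hℓη hρη haε =ᶠ[𝓝 (u, s)] fun q ↦ (S.c₀ sg hsg am l δ ham hl hδ hδ8 hl_le hδ_room hδ_up hδ_clean hη1 hℓη hρη haε).c q + S.corr sg hsg am l δ ham hl hδ hδ8 hl_le hδ_room hδ_up hδ_clean hη1 hℓη hρη haε q.2 (q.1 - n) := by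
  obtain ⟨n, hn, hloc⟩ := periodise_family_eventuallyEq (a := (S.md sg hsg am l δ ham hl hδ hδ8 hl_le hδ_room hδ_up hδ_clean).chart.θlo - 1 / 2) (F := S.corr sg hsg am l δ ham hl hδ hδ8 hl_le hδ_room hδ_up hδ_clean hη1 hℓη hρη haε)
    (by norm_num : (0 : ℝ) < 1 / 4) (S.corr_seam sg hsg am l δ ham hl hδ hδ8 hl_le hδ_room hδ_up hδ_clean hη1 hℓη hρη haε) (s, u)
  refine ⟨n, hn, ?_⟩
  have hswap : Tendsto (fun q : ℝ × ℝ ↦ (q.2, q.1)) (𝓝 (u, s)) (𝓝 (s, u)) :=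
    (continuous_swap.tendsto (u, s))
  have h := hloc.comp_tendsto hswap
  filter_upwards [h] with q hq
  simp only [comp_apply] at hq
  show (S.c₀ sg hsg am l δ ham hl hδ hδ8 hl_le hδ_room hδ_up hδ_clean hη1 hℓη hρη haε).c q + periodise ((S.md sg hsg am l δ ham hl hδ hδ8 hl_le hδ_room hδ_up hδ_clean).chart.θlo - 1 / 2) (S.corr sg hsg am l δ ham hl hδ hδ8 hl_le hδ_room hδ_up hδ_clean hη1 hℓη hρη haε q.2) q.1 = _
  rw [hq]

/-- **The surface is an immersion** over levels in `[1, 2]`. [folklore] -/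
theorem injective_fderiv_surf (p : ℝ × ℝ) (hp : p.2 ∈ Icc (1 : ℝ) 2) :
    Injective (fderiv ℝ (S.surf sg hsg am l δ ham hl hδ hδ8 hl_le hδ_room hδ_up hδ_clean hη1 hℓη hρη haε) p) := by
  obtain ⟨u, s⟩ := p
  simp only at hp
  obtain ⟨n, hn, hloc⟩ := S.surf_eventuallyEq sg hsg am l δ ham hl hδ hδ8 hl_le hδ_room hδ_up hδ_clean hη1 hℓη hρη haε u s
  by_cases hb : u - n ∈ Ioo (S.md sg hsg am l δ ham hl hδ hδ8 hl_le hδ_room hδ_up hδ_clean).seg'.uA (S.md sg hsg am l δ ham hl hδ hδ8 hl_le hδ_room hδ_up hδ_clean).seg'.uD ∧ ¬ S.Zone ((S.md sg hsg am l δ ham hl hδ hδ8 hl_le hδ_room hδ_up hδ_clean).seg'.θhat (u - n))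
  · -- body: locally the shifted moving picture
    obtain ⟨hα, hβ⟩ := S.seg'_αβ sg hsg am l δ ham hl hδ hδ8 hl_le hδ_room hδ_up hδ_clean
    have hg := S.gap_pos
    have hg' := S.gap_pos
    rw [gap] at hg'
    have hA := (S.md sg hsg am l δ ham hl hδ hδ8 hl_le hδ_room hδ_up hδ_clean).seg'.θA_spec.1
    have hD := (S.md sg hsg am l δ ham hl hδ hδ8 hl_le hδ_room hδ_up hδ_clean).seg'.θD_spec.1
    have hmono := (S.md sg hsg am l δ ham hl hδ hδ8 hl_le hδ_room hδ_up hδ_clean).seg'.strictMono_θhat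
    have hr1 : (S.md sg hsg am l δ ham hl hδ hδ8 hl_le hδ_room hδ_up hδ_clean).seg'.θA < (S.md sg hsg am l δ ham hl hδ hδ8 hl_le hδ_room hδ_up hδ_clean).seg'.θhat (u - n) := by
      have := hmono hb.1.1
      rwa [(S.md sg hsg am l δ ham hl hδ hδ8 hl_le hδ_room hδ_up hδ_clean).seg'.θhat_of_le (u := (S.md sg hsg am l δ ham hl hδ hδ8 hl_le hδ_room hδ_up hδ_clean).seg'.uA) (by linarith [(S.md sg hsg am l δ ham hl hδ hδ8 hl_le hδ_room hδ_up hδ_clean).seg'.c₁_pos]), sub_self, mul_zero, add_zero] at this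
    have hr2 : (S.md sg hsg am l δ ham hl hδ hδ8 hl_le hδ_room hδ_up hδ_clean).seg'.θhat (u - n) < (S.md sg hsg am l δ ham hl hδ hδ8 hl_le hδ_room hδ_up hδ_clean).seg'.θD + 2 * π := by
      have := hmono hb.1.2
      rwa [(S.md sg hsg am l δ ham hl hδ hδ8 hl_le hδ_room hδ_up hδ_clean).seg'.θhat_of_ge (u := (S.md sg hsg am l δ ham hl hδ hδ8 hl_le hδ_room hδ_up hδ_clean).seg'.uD) (by linarith [(S.md sg hsg am l δ ham hl hδ hδ8 hl_le hδ_room hδ_up hδ_clean).seg'.c₁_pos]), sub_self, mul_zero, add_zero] at this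
    have hmem := S.mem_of_not_zone (t := (S.md sg hsg am l δ ham hl hδ hδ8 hl_le hδ_room hδ_up hδ_clean).seg'.θhat (u - n)) (by rw [hα] at hA; linarith [hA.1])
      (by rw [hβ] at hD; linarith [hD.2]) hb.2
    -- the open set where `χ = 1` and `v ∈ (uA, uD)`
    set U : Set ℝ := {v | v ∈ Ioo (S.md sg hsg am l δ ham hl hδ hδ8 hl_le hδ_room hδ_up hδ_clean).seg'.uA (S.md sg hsg am l δ ham hl hδ hδ8 hl_le hδ_room hδ_up hδ_clean).seg'.uD ∧
      (S.md sg hsg am l δ ham hl hδ hδ8 hl_le hδ_room hδ_up hδ_clean).seg'.θhat v ∈ Ioo ((S.md sg hsg am l δ ham hl hδ hδ8 hl_le hδ_room hδ_up hδ_clean).seg'.β + 2 * S.gap / 3) ((S.md sg hsg am l δ ham hl hδ hδ8 hl_le hδ_room hδ_up hδ_clean).seg'.α + 2 * π - 2 * S.gap / 3)} with hU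
    have hUo : IsOpen U := isOpen_Ioo.inter (isOpen_Ioo.preimage (S.md sg hsg am l δ ham hl hδ hδ8 hl_le hδ_room hδ_up hδ_clean).seg'.contDiff_θhat.continuous)
    have huU : u - n ∈ U := by
      refine ⟨hb.1, ?_, ?_⟩
      · rw [hβ, gap]; linarith [hmem.1]
      · rw [hα, gap]; linarith [hmem.2]
    have hcont : ContinuousAt (fun q : ℝ × ℝ ↦ q.1 - (n : ℝ)) (u, s) := (continuous_fst.sub continuous_const).continuousAt
    have hev : ∀ᶠ q : ℝ × ℝ in 𝓝 (u, s), q.1 - n ∈ U :=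
      hcont.preimage_mem_nhds (hUo.mem_nhds (show (fun q : ℝ × ℝ ↦ q.1 - (n : ℝ)) (u, s) ∈ U from huU))
    have hloc2 : S.surf sg hsg am l δ ham hl hδ hδ8 hl_le hδ_room hδ_up hδ_clean hη1 hℓη hρη haε =ᶠ[𝓝 (u, s)] fun q : ℝ × ℝ ↦
        shuffle (S.moving sg hsg am l δ ham hl hδ hδ8 hl_le hδ_room hδ_up hδ_clean ((2 * π)⁻¹ * (S.md sg hsg am l δ ham hl hδ hδ8 hl_le hδ_room hδ_up hδ_clean).seg'.θhat (q.1 - n), q.2)) + (((n : ℝ), 0), (0, 0)) := by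
      filter_upwards [hloc, hev] with q hq hqU
      rw [hq]
      have h1 : S.χ sg hsg am l δ ham hl hδ hδ8 hl_le hδ_room hδ_up hδ_clean (q.1 - n) = 1 := S.χ_eq_one sg hsg am l δ ham hl hδ hδ8 hl_le hδ_room hδ_up hδ_clean hqU.2.1.le hqU.2.2.le
      simp only [corr]
      rw [h1, one_smul, S.c₀_unshift sg hsg am l δ ham hl hδ hδ8 hl_le hδ_room hδ_up hδ_clean hη1 hℓη hρη haε q.1 q.2 n]
      abel
    rw [hloc2.fderiv_eq]
    exact S.injective_fderiv_movingBody sg hsg am l δ ham hl hδ hδ8 hl_le hδ_room hδ_up hδ_clean n _ hp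
  · -- off the body: locally the static detour
    have hcrit := S.crit_of_not_body sg hsg am l δ ham hl hδ hδ8 hl_le hδ_room hδ_up hδ_clean hb
    have hcont : ContinuousAt (fun q : ℝ × ℝ ↦ q.1 - (n : ℝ)) (u, s) := (continuous_fst.sub continuous_const).continuousAt
    have hev : ∀ᶠ q : ℝ × ℝ in 𝓝 (u, s),
        q.1 - n < (S.md sg hsg am l δ ham hl hδ hδ8 hl_le hδ_room hδ_up hδ_clean).seg'.uA ∨ (S.md sg hsg am l δ ham hl hδ hδ8 hl_le hδ_room hδ_up hδ_clean).seg'.uD < q.1 - n ∨ S.Zone ((S.md sg hsg am l δ ham hl hδ hδ8 hl_le hδ_room hδ_up hδ_clean).seg'.θhat (q.1 - n)) :=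
      hcont.preimage_mem_nhds ((S.isOpen_crit sg hsg am l δ ham hl hδ hδ8 hl_le hδ_room hδ_up hδ_clean).mem_nhds
        (show (fun q : ℝ × ℝ ↦ q.1 - (n : ℝ)) (u, s) ∈ {v : ℝ | v < (S.md sg hsg am l δ ham hl hδ hδ8 hl_le hδ_room hδ_up hδ_clean).seg'.uA ∨ (S.md sg hsg am l δ ham hl hδ hδ8 hl_le hδ_room hδ_up hδ_clean).seg'.uD < v ∨ S.Zone ((S.md sg hsg am l δ ham hl hδ hδ8 hl_le hδ_room hδ_up hδ_clean).seg'.θhat v)}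
          from hcrit))
    have hloc2 : S.surf sg hsg am l δ ham hl hδ hδ8 hl_le hδ_room hδ_up hδ_clean hη1 hℓη hρη haε =ᶠ[𝓝 (u, s)] (S.c₀ sg hsg am l δ ham hl hδ hδ8 hl_le hδ_room hδ_up hδ_clean hη1 hℓη hρη haε).c := by
      filter_upwards [hloc, hev] with q hq hqc
      rw [hq, S.corr_eq_zero_of_crit sg hsg am l δ ham hl hδ hδ8 hl_le hδ_room hδ_up hδ_clean hη1 hℓη hρη haε hqc, add_zero]
    rw [hloc2.fderiv_eq]
    exact (S.c₀ sg hsg am l δ ham hl hδ hδ8 hl_le hδ_room hδ_up hδ_clean hη1 hℓη hρη haε).injective_fderiv (u, s) hp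

/-! ### The two-sided surface detour -/

/-- **The two-sided surface detour.** [folklore] -/
def surfaceDetour : SurfaceDetour 0 η ε ηD where
  c := S.surf sg hsg am l δ ham hl hδ hδ8 hl_le hδ_room hδ_up hδ_clean hη1 hℓη hρη haε
  contDiff_c := S.contDiff_surf sg hsg am l δ ham hl hδ hδ8 hl_le hδ_room hδ_up hδ_clean hη1 hℓη hρη haε
  τ_pos := D.η_pos
  c_add_one u s := by
    have h : S.surf sg hsg am l δ ham hl hδ hδ8 hl_le hδ_room hδ_up hδ_clean hη1 hℓη hρη haε (u + 1, s) = S.surf sg hsg am l δ ham hl hδ hδ8 hl_le hδ_room hδ_up hδ_clean hη1 hℓη hρη haε (u, s) + (((1 : ℝ), 0), (0, 0)) := by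
      have hper := periodic_periodise ((S.md sg hsg am l δ ham hl hδ hδ8 hl_le hδ_room hδ_up hδ_clean).chart.θlo - 1 / 2) (S.corr sg hsg am l δ ham hl hδ hδ8 hl_le hδ_room hδ_up hδ_clean hη1 hℓη hρη haε s) u
      have h1 := S.c₀_shift sg hsg am l δ ham hl hδ hδ8 hl_le hδ_room hδ_up hδ_clean hη1 hℓη hρη haε u s 1
      push_cast at h1
      simp only [surf]
      rw [hper, h1]
      abel
    show S.surf sg hsg am l δ ham hl hδ hδ8 hl_le hδ_room hδ_up hδ_clean hη1 hℓη hρη haε (u + 1, s) = _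
    rw [h]
    exact Prod.ext (Prod.ext (by simp) (by simp)) (by simp)
  c_of_not_inArc u s hu := by
    obtain ⟨n, hn⟩ := exists_toIcoMod_one_eq ((S.md sg hsg am l δ ham hl hδ hδ8 hl_le hδ_room hδ_up hδ_clean).chart.θlo - 1 / 2) u
    have hv : u - n ∉ Ioo (S.md sg hsg am l δ ham hl hδ hδ8 hl_le hδ_room hδ_up hδ_clean).seg'.uA (S.md sg hsg am l δ ham hl hδ hδ8 hl_le hδ_room hδ_up hδ_clean).seg'.uD := fun h ↦ hu (by
      rw [inArc_iff]
      refine ⟨n, ?_⟩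
      have := S.Ioo_sub_arc sg hsg am l δ ham hl hδ hδ8 hl_le hδ_room hδ_up hδ_clean hη1 hℓη hρη haε h
      rw [zero_sub, zero_add]; exact this)
    show S.surf sg hsg am l δ ham hl hδ hδ8 hl_le hδ_room hδ_up hδ_clean hη1 hℓη hρη haε (u, s) = _
    rw [S.surf_eq_c₀_of sg hsg am l δ ham hl hδ hδ8 hl_le hδ_room hδ_up hδ_clean hη1 hℓη hρη haε hn (Or.inl hv), (S.c₀ sg hsg am l δ ham hl hδ hδ8 hl_le hδ_room hδ_up hδ_clean hη1 hℓη hρη haε).c_of_not_inArc u s hu]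
  angle_mem u hu s := by
    obtain ⟨n, hn⟩ := exists_toIcoMod_one_eq ((S.md sg hsg am l δ ham hl hδ hδ8 hl_le hδ_room hδ_up hδ_clean).chart.θlo - 1 / 2) u
    show (S.surf sg hsg am l δ ham hl hδ hδ8 hl_le hδ_room hδ_up hδ_clean hη1 hℓη hρη haε (u, s)).1.1 ∈ _
    by_cases hb : u - n ∈ Ioo (S.md sg hsg am l δ ham hl hδ hδ8 hl_le hδ_room hδ_up hδ_clean).seg'.uA (S.md sg hsg am l δ ham hl hδ hδ8 hl_le hδ_room hδ_up hδ_clean).seg'.uD ∧ ¬ S.Zone ((S.md sg hsg am l δ ham hl hδ hδ8 hl_le hδ_room hδ_up hδ_clean).seg'.θhat (u - n))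
    · rw [S.surf_of_body sg hsg am l δ ham hl hδ hδ8 hl_le hδ_room hδ_up hδ_clean hη1 hℓη hρη haε hn hb.1 hb.2]
      simp only [Prod.fst_add, shuffle]
      have harc := S.Ioo_sub_arc sg hsg am l δ ham hl hδ hδ8 hl_le hδ_room hδ_up hδ_clean hη1 hℓη hρη haε hb.1
      rw [zero_sub, zero_add] at hu ⊢
      have T := S.tubeFit₁ sg hsg am l δ ham hl hδ hδ8 hl_le hδ_room hδ_up hδ_clean hη1 hℓη hρη haε
      have hη := T.η_pos
      have hn0 : n = 0 := by
        have : |(n : ℝ)| < 1 := by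
          rw [abs_lt]; constructor <;> linarith [hu.1, hu.2, harc.1, harc.2, T.η_le]
        have : |n| < (1 : ℤ) := by exact_mod_cast this
        exact Int.abs_lt_one_iff.1 this
      subst hn0
      have hb1 := (S.moving_bounds sg hsg am l δ ham hl hδ hδ8 hl_le hδ_room hδ_up hδ_clean ((2 * π)⁻¹ * (S.md sg hsg am l δ ham hl hδ hδ8 hl_le hδ_room hδ_up hδ_clean).seg'.θhat (u - (0 : ℤ)), s)).1
      have hρ := S.two_l_ρ'_le_eta l hρη
      rw [abs_le] at hb1
      push_cast
      exact ⟨by linarith [hb1.1], by linarith [hb1.2]⟩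
    · rw [S.surf_eq_c₀_of sg hsg am l δ ham hl hδ hδ8 hl_le hδ_room hδ_up hδ_clean hη1 hℓη hρη haε hn (by tauto)]
      exact (S.c₀ sg hsg am l δ ham hl hδ hδ8 hl_le hδ_room hδ_up hδ_clean hη1 hℓη hρη haε).angle_mem u hu s
  normal_mem p := by
    obtain ⟨u, s⟩ := p
    obtain ⟨n, hn⟩ := exists_toIcoMod_one_eq ((S.md sg hsg am l δ ham hl hδ hδ8 hl_le hδ_room hδ_up hδ_clean).chart.θlo - 1 / 2) u
    show (S.surf sg hsg am l δ ham hl hδ hδ8 hl_le hδ_room hδ_up hδ_clean hη1 hℓη hρη haε (u, s)).2 ∈ _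
    by_cases hb : u - n ∈ Ioo (S.md sg hsg am l δ ham hl hδ hδ8 hl_le hδ_room hδ_up hδ_clean).seg'.uA (S.md sg hsg am l δ ham hl hδ hδ8 hl_le hδ_room hδ_up hδ_clean).seg'.uD ∧ ¬ S.Zone ((S.md sg hsg am l δ ham hl hδ hδ8 hl_le hδ_room hδ_up hδ_clean).seg'.θhat (u - n))
    · rw [S.surf_of_body sg hsg am l δ ham hl hδ hδ8 hl_le hδ_room hδ_up hδ_clean hη1 hℓη hρη haε hn hb.1 hb.2]
      simp only [shuffle, Prod.mk_add_mk, add_zero]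
      obtain ⟨-, h1, h2, h3⟩ := S.moving_bounds sg hsg am l δ ham hl hδ hδ8 hl_le hδ_room hδ_up hδ_clean ((2 * π)⁻¹ * (S.md sg hsg am l δ ham hl hδ hδ8 hl_le hδ_room hδ_up hδ_clean).seg'.θhat (u - n), s)
      have hρ : 2 * l * (‖S.x₀‖ + 2 * S.a + 1) ≤ am / 8 := S.two_l_ρ'_le_am sg hsg am l δ ham hl hδ hδ8 hl_le hδ_room hδ_up hδ_clean
      rw [abs_le] at h3
      rw [mem_ball_zero_iff, Prod.norm_mk, Real.norm_eq_abs, Real.norm_eq_abs, max_lt_iff, abs_lt, abs_lt]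
      exact ⟨⟨by linarith, by linarith⟩, ⟨by linarith, by linarith⟩⟩
    · rw [S.surf_eq_c₀_of sg hsg am l δ ham hl hδ hδ8 hl_le hδ_room hδ_up hδ_clean hη1 hℓη hρη haε hn (by tauto)]
      exact (S.c₀ sg hsg am l δ ham hl hδ hδ8 hl_le hδ_room hδ_up hδ_clean hη1 hℓη hρη haε).normal_mem (u, s)
  time_mem_Icc u s hs := by
    obtain ⟨n, hn⟩ := exists_toIcoMod_one_eq ((S.md sg hsg am l δ ham hl hδ hδ8 hl_le hδ_room hδ_up hδ_clean).chart.θlo - 1 / 2) u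
    show (S.surf sg hsg am l δ ham hl hδ hδ8 hl_le hδ_room hδ_up hδ_clean hη1 hℓη hρη haε (u, s)).1.2 ∈ _
    by_cases hb : u - n ∈ Ioo (S.md sg hsg am l δ ham hl hδ hδ8 hl_le hδ_room hδ_up hδ_clean).seg'.uA (S.md sg hsg am l δ ham hl hδ hδ8 hl_le hδ_room hδ_up hδ_clean).seg'.uD ∧ ¬ S.Zone ((S.md sg hsg am l δ ham hl hδ hδ8 hl_le hδ_room hδ_up hδ_clean).seg'.θhat (u - n))
    · rw [S.surf_of_body sg hsg am l δ ham hl hδ hδ8 hl_le hδ_room hδ_up hδ_clean hη1 hℓη hρη haε hn hb.1 hb.2]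
      simp only [Prod.fst_add, Prod.snd_add, shuffle, add_zero, moving]
      have := D.margin 0 ⟨le_rfl, D.η_pos.le⟩ ((2 * π)⁻¹ * (S.md sg hsg am l δ ham hl hδ hδ8 hl_le hδ_room hδ_up hδ_clean).seg'.θhat (u - n)) s (by simpa using hs)
      simpa using this
    · rw [S.surf_eq_c₀_of sg hsg am l δ ham hl hδ hδ8 hl_le hδ_room hδ_up hδ_clean hη1 hℓη hρη haε hn (by tauto)]
      exact (S.c₀ sg hsg am l δ ham hl hδ hδ8 hl_le hδ_room hδ_up hδ_clean hη1 hℓη hρη haε).time_mem_Icc u s hs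
  time_mem_Ioo u s hs := by
    obtain ⟨n, hn⟩ := exists_toIcoMod_one_eq ((S.md sg hsg am l δ ham hl hδ hδ8 hl_le hδ_room hδ_up hδ_clean).chart.θlo - 1 / 2) u
    show (S.surf sg hsg am l δ ham hl hδ hδ8 hl_le hδ_room hδ_up hδ_clean hη1 hℓη hρη haε (u, s)).1.2 ∈ _
    by_cases hb : u - n ∈ Ioo (S.md sg hsg am l δ ham hl hδ hδ8 hl_le hδ_room hδ_up hδ_clean).seg'.uA (S.md sg hsg am l δ ham hl hδ hδ8 hl_le hδ_room hδ_up hδ_clean).seg'.uD ∧ ¬ S.Zone ((S.md sg hsg am l δ ham hl hδ hδ8 hl_le hδ_room hδ_up hδ_clean).seg'.θhat (u - n))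
    · rw [S.surf_of_body sg hsg am l δ ham hl hδ hδ8 hl_le hδ_room hδ_up hδ_clean hη1 hℓη hρη haε hn hb.1 hb.2]
      simp only [Prod.fst_add, Prod.snd_add, shuffle, add_zero, moving]
      have := D.margin_Ioo 0 ⟨le_rfl, D.η_pos.le⟩ ((2 * π)⁻¹ * (S.md sg hsg am l δ ham hl hδ hδ8 hl_le hδ_room hδ_up hδ_clean).seg'.θhat (u - n)) s (by simpa using hs)
      simpa using this
    · rw [S.surf_eq_c₀_of sg hsg am l δ ham hl hδ hδ8 hl_le hδ_room hδ_up hδ_clean hη1 hℓη hρη haε hn (by tauto)]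
      exact (S.c₀ sg hsg am l δ ham hl hδ hδ8 hl_le hδ_room hδ_up hδ_clean hη1 hℓη hρη haε).time_mem_Ioo u s hs
  c_of_le u s hs := by
    show S.surf sg hsg am l δ ham hl hδ hδ8 hl_le hδ_room hδ_up hδ_clean hη1 hℓη hρη haε (u, s) = (((S.surf sg hsg am l δ ham hl hδ hδ8 hl_le hδ_room hδ_up hδ_clean hη1 hℓη hρη haε (u, 1)).1.1, s), (S.surf sg hsg am l δ ham hl hδ hδ8 hl_le hδ_room hδ_up hδ_clean hη1 hℓη hρη haε (u, 1)).2)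
    set v := toIcoMod zero_lt_one ((S.md sg hsg am l δ ham hl hδ hδ8 hl_le hδ_room hδ_up hδ_clean).chart.θlo - 1 / 2) u with hv
    have hcorr : S.corr sg hsg am l δ ham hl hδ hδ8 hl_le hδ_room hδ_up hδ_clean hη1 hℓη hρη haε s v = S.corr sg hsg am l δ ham hl hδ hδ8 hl_le hδ_room hδ_up hδ_clean hη1 hℓη hρη haε 1 v := by
      simp only [corr, moving, shuffle, c₀_c, D.collar₁ _ s hs, D.collar₁ _ 1 (by linarith [D.η_pos]), Prod.mk_sub_mk,
        sub_self]
    simp only [surf, periodise]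
    rw [← hv, hcorr, c₀_c, c₀_c]
    have ht := S.corr_time₁ sg hsg am l δ ham hl hδ hδ8 hl_le hδ_room hδ_up hδ_clean hη1 hℓη hρη haε (s := 1) (by linarith [D.η_pos]) v
    ext <;> simp [ht]
  c_of_ge u s hs := by
    show S.surf sg hsg am l δ ham hl hδ hδ8 hl_le hδ_room hδ_up hδ_clean hη1 hℓη hρη haε (u, s) = (((S.surf sg hsg am l δ ham hl hδ hδ8 hl_le hδ_room hδ_up hδ_clean hη1 hℓη hρη haε (u, 2)).1.1, s), (S.surf sg hsg am l δ ham hl hδ hδ8 hl_le hδ_room hδ_up hδ_clean hη1 hℓη hρη haε (u, 2)).2)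
    set v := toIcoMod zero_lt_one ((S.md sg hsg am l δ ham hl hδ hδ8 hl_le hδ_room hδ_up hδ_clean).chart.θlo - 1 / 2) u with hv
    have hcorr : S.corr sg hsg am l δ ham hl hδ hδ8 hl_le hδ_room hδ_up hδ_clean hη1 hℓη hρη haε s v = S.corr sg hsg am l δ ham hl hδ hδ8 hl_le hδ_room hδ_up hδ_clean hη1 hℓη hρη haε 2 v := by
      simp only [corr, moving, shuffle, c₀_c, D.collar₂ _ s hs, D.collar₂ _ 2 (by linarith [D.η_pos]), Prod.mk_sub_mk,
        sub_self]
    simp only [surf, periodise]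
    rw [← hv, hcorr, c₀_c, c₀_c]
    have ht := S.corr_time₂ sg hsg am l δ ham hl hδ hδ8 hl_le hδ_room hδ_up hδ_clean hη1 hℓη hρη haε (s := 2) (by linarith [D.η_pos]) v
    ext <;> simp [ht]
  inj p q hp hq he := by
    obtain ⟨u, s⟩ := p
    obtain ⟨u', s'⟩ := q
    simp only at hp hq
    change S.surf sg hsg am l δ ham hl hδ hδ8 hl_le hδ_room hδ_up hδ_clean hη1 hℓη hρη haε (u, s) = S.surf sg hsg am l δ ham hl hδ hδ8 hl_le hδ_room hδ_up hδ_clean hη1 hℓη hρη haε (u', s') at he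
    obtain ⟨n, hn⟩ := exists_toIcoMod_one_eq ((S.md sg hsg am l δ ham hl hδ hδ8 hl_le hδ_room hδ_up hδ_clean).chart.θlo - 1 / 2) u
    obtain ⟨n', hn'⟩ := exists_toIcoMod_one_eq ((S.md sg hsg am l δ ham hl hδ hδ8 hl_le hδ_room hδ_up hδ_clean).chart.θlo - 1 / 2) u'
    by_cases hb : u - n ∈ Ioo (S.md sg hsg am l δ ham hl hδ hδ8 hl_le hδ_room hδ_up hδ_clean).seg'.uA (S.md sg hsg am l δ ham hl hδ hδ8 hl_le hδ_room hδ_up hδ_clean).seg'.uD ∧ ¬ S.Zone ((S.md sg hsg am l δ ham hl hδ hδ8 hl_le hδ_room hδ_up hδ_clean).seg'.θhat (u - n)) <;>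
      by_cases hb' : u' - n' ∈ Ioo (S.md sg hsg am l δ ham hl hδ hδ8 hl_le hδ_room hδ_up hδ_clean).seg'.uA (S.md sg hsg am l δ ham hl hδ hδ8 hl_le hδ_room hδ_up hδ_clean).seg'.uD ∧ ¬ S.Zone ((S.md sg hsg am l δ ham hl hδ hδ8 hl_le hδ_room hδ_up hδ_clean).seg'.θhat (u' - n'))
    · rw [S.surf_of_body sg hsg am l δ ham hl hδ hδ8 hl_le hδ_room hδ_up hδ_clean hη1 hℓη hρη haε hn hb.1 hb.2, S.surf_of_body sg hsg am l δ ham hl hδ hδ8 hl_le hδ_room hδ_up hδ_clean hη1 hℓη hρη haε hn' hb'.1 hb'.2] at he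
      obtain ⟨hss, hu⟩ := S.eq_of_moving_eq sg hsg am l δ ham hl hδ hδ8 hl_le hδ_room hδ_up hδ_clean hη1 hρη hp hq hb.1 hb'.1 he
      exact ⟨hss, _, hu⟩
    · rw [S.surf_of_body sg hsg am l δ ham hl hδ hδ8 hl_le hδ_room hδ_up hδ_clean hη1 hℓη hρη haε hn hb.1 hb.2, S.surf_eq_c₀_of sg hsg am l δ ham hl hδ hδ8 hl_le hδ_room hδ_up hδ_clean hη1 hℓη hρη haε hn' (by tauto)] at he
      exact (S.moving_ne_static sg hsg am l δ ham hl hδ hδ8 hl_le hδ_room hδ_up hδ_clean hη1 hℓη hρη haε hp hq hb.2 hn' (by tauto) he).elim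
    · rw [S.surf_eq_c₀_of sg hsg am l δ ham hl hδ hδ8 hl_le hδ_room hδ_up hδ_clean hη1 hℓη hρη haε hn (by tauto), S.surf_of_body sg hsg am l δ ham hl hδ hδ8 hl_le hδ_room hδ_up hδ_clean hη1 hℓη hρη haε hn' hb'.1 hb'.2] at he
      exact (S.moving_ne_static sg hsg am l δ ham hl hδ hδ8 hl_le hδ_room hδ_up hδ_clean hη1 hℓη hρη haε hq hp hb'.2 hn (by tauto) he.symm).elim
    · rw [S.surf_eq_c₀_of sg hsg am l δ ham hl hδ hδ8 hl_le hδ_room hδ_up hδ_clean hη1 hℓη hρη haε hn (by tauto), S.surf_eq_c₀_of sg hsg am l δ ham hl hδ hδ8 hl_le hδ_room hδ_up hδ_clean hη1 hℓη hρη haε hn' (by tauto)] at he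
      exact (S.c₀ sg hsg am l δ ham hl hδ hδ8 hl_le hδ_room hδ_up hδ_clean hη1 hℓη hρη haε).inj (u, s) (u', s') hp hq he
  injective_fderiv p hp := S.injective_fderiv_surf sg hsg am l δ ham hl hδ hδ8 hl_le hδ_room hδ_up hδ_clean hη1 hℓη hρη haε p hp

/-- The coordinates of the two-sided surface detour. [folklore] -/
theorem surfaceDetour_c (p : ℝ × ℝ) : (S.surfaceDetour sg hsg am l δ ham hl hδ hδ8 hl_le hδ_room hδ_up hδ_clean hη1 hℓη hρη haε).c p = S.surf sg hsg am l δ ham hl hδ hδ8 hl_le hδ_room hδ_up hδ_clean hη1 hℓη hρη haε p := rfl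

/-! ### The end slices are the two static detours -/

omit hη1 hℓη hρη haε in
/-- **In the zone the two knot pieces agree.** [folklore] -/
theorem piece₂_k_eq_of_zone {t : ℝ} (hz : S.Zone t) : (S.piece₂ sg hsg am l δ ham hl hδ hδ8 hl_le hδ_room hδ_up hδ_clean).k t = (S.md sg hsg am l δ ham hl hδ hδ8 hl_le hδ_room hδ_up hδ_clean).piece.k t := by
  have h1 := S.moving_of_strip sg hsg am l δ ham hl hδ hδ8 hl_le hδ_room hδ_up hδ_clean hz 1
  have h2 := S.moving_of_strip₂ sg hsg am l δ ham hl hδ hδ8 hl_le hδ_room hδ_up hδ_clean hz 1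
  have ht : 2 * π * ((2 * π)⁻¹ * t) = t := by rw [← mul_assoc, mul_inv_cancel₀ (by positivity), one_mul]
  rw [ht] at h1 h2
  have := h1.symm.trans h2
  exact (congrArg Prod.fst this).symm

omit hη1 hℓη hρη haε in
/-- **Off the body the two glued curves agree.** [folklore] -/
theorem curve₂_eq {v : ℝ} (h : v ∉ Ioo (S.md sg hsg am l δ ham hl hδ hδ8 hl_le hδ_room hδ_up hδ_clean).seg'.uA (S.md sg hsg am l δ ham hl hδ hδ8 hl_le hδ_room hδ_up hδ_clean).seg'.uD ∨ S.Zone ((S.md sg hsg am l δ ham hl hδ hδ8 hl_le hδ_room hδ_up hδ_clean).seg'.θhat v)) :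
    (S.piece₂ sg hsg am l δ ham hl hδ hδ8 hl_le hδ_room hδ_up hδ_clean).curve v = (S.md sg hsg am l δ ham hl hδ hδ8 hl_le hδ_room hδ_up hδ_clean).piece.curve v := by
  by_cases hmid : v ∈ Ioc (S.md sg hsg am l δ ham hl hδ hδ8 hl_le hδ_room hδ_up hδ_clean).seg'.uA (S.md sg hsg am l δ ham hl hδ hδ8 hl_le hδ_room hδ_up hδ_clean).seg'.uD
  · have hz : S.Zone ((S.md sg hsg am l δ ham hl hδ hδ8 hl_le hδ_room hδ_up hδ_clean).seg'.θhat v) := by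
      rcases h with h | h
      · have hvD : v = (S.md sg hsg am l δ ham hl hδ hδ8 hl_le hδ_room hδ_up hδ_clean).seg'.uD := le_antisymm hmid.2 (by by_contra hlt; exact h ⟨hmid.1, not_le.1 hlt⟩)
        obtain ⟨hα, hβ⟩ := S.seg'_αβ sg hsg am l δ ham hl hδ hδ8 hl_le hδ_room hδ_up hδ_clean
        have hD := (S.md sg hsg am l δ ham hl hδ hδ8 hl_le hδ_room hδ_up hδ_clean).seg'.θD_spec.1
        have hg := S.gap_pos
        rw [hα, hβ] at hD
        rw [gap] at hg
        apply S.zone_of_mem₁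
        rw [hvD, (S.md sg hsg am l δ ham hl hδ hδ8 hl_le hδ_room hδ_up hδ_clean).seg'.θhat_of_ge (u := (S.md sg hsg am l δ ham hl hδ hδ8 hl_le hδ_room hδ_up hδ_clean).seg'.uD) (by linarith [(S.md sg hsg am l δ ham hl hδ hδ8 hl_le hδ_room hδ_up hδ_clean).seg'.c₁_pos]), sub_self, mul_zero, add_zero]
        exact ⟨by linarith [hD.1], by linarith [hD.2]⟩
      · exact h
    rw [(S.piece₂ sg hsg am l δ ham hl hδ hδ8 hl_le hδ_room hδ_up hδ_clean).curve_of_mem_mid hmid, (S.md sg hsg am l δ ham hl hδ hδ8 hl_le hδ_room hδ_up hδ_clean).piece.curve_of_mem_mid hmid, KnotPiece.pMid, KnotPiece.pMid,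
      S.piece₂_k_eq_of_zone sg hsg am l δ ham hl hδ hδ8 hl_le hδ_room hδ_up hδ_clean hz]
  · rw [mem_Ioc, not_and_or, not_lt, not_le] at hmid
    rcases hmid with h1 | h1
    · rcases le_or_gt v (S.md sg hsg am l δ ham hl hδ hδ8 hl_le hδ_room hδ_up hδ_clean).chart.θlo with h2 | h2
      · rw [(S.piece₂ sg hsg am l δ ham hl hδ hδ8 hl_le hδ_room hδ_up hδ_clean).curve_of_le h2, (S.md sg hsg am l δ ham hl hδ hδ8 hl_le hδ_room hδ_up hδ_clean).piece.curve_of_le h2]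
      · rw [(S.piece₂ sg hsg am l δ ham hl hδ hδ8 hl_le hδ_room hδ_up hδ_clean).curve_of_mem_lo ⟨h2, h1⟩, (S.md sg hsg am l δ ham hl hδ hδ8 hl_le hδ_room hδ_up hδ_clean).piece.curve_of_mem_lo ⟨h2, h1⟩]
    · rcases le_or_gt v (S.md sg hsg am l δ ham hl hδ hδ8 hl_le hδ_room hδ_up hδ_clean).chart.θhi with h2 | h2
      · rw [(S.piece₂ sg hsg am l δ ham hl hδ hδ8 hl_le hδ_room hδ_up hδ_clean).curve_of_mem_up ⟨h1, h2⟩, (S.md sg hsg am l δ ham hl hδ hδ8 hl_le hδ_room hδ_up hδ_clean).piece.curve_of_mem_up ⟨h1, h2⟩]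
      · rw [(S.piece₂ sg hsg am l δ ham hl hδ hδ8 hl_le hδ_room hδ_up hδ_clean).curve_of_gt h2, (S.md sg hsg am l δ ham hl hδ hδ8 hl_le hδ_room hδ_up hδ_clean).piece.curve_of_gt h2]

omit hη1 hℓη hρη haε in
/-- The shuffle of a shifted curve point. [folklore] -/
theorem shuffle_add_e3 (y : 𝔼 3) (t : ℝ) (n : ℤ) :
    shuffle (y + (n : ℝ) • ChartData.e3 0, t) = shuffle (y, t) + (((n : ℝ), 0), (0, 0)) := by
  simp [shuffle, ChartData.e3]

/-- **The slice at `s = 1` is the static detour of the lower piece.** [folklore] -/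
theorem surfaceDetour_c_one (u : ℝ) : (S.surfaceDetour sg hsg am l δ ham hl hδ hδ8 hl_le hδ_room hδ_up hδ_clean hη1 hℓη hρη haε).c (u, 1) =
    (((KnotPiece.detour (S.tubeFit₁ sg hsg am l δ ham hl hδ hδ8 hl_le hδ_room hδ_up hδ_clean hη1 hℓη hρη haε)).κθ u, 1), (KnotPiece.detour (S.tubeFit₁ sg hsg am l δ ham hl hδ hδ8 hl_le hδ_room hδ_up hδ_clean hη1 hℓη hρη haε)).κd u) := by
  rw [surfaceDetour_c]
  obtain ⟨n, hn⟩ := exists_toIcoMod_one_eq ((S.md sg hsg am l δ ham hl hδ hδ8 hl_le hδ_room hδ_up hδ_clean).chart.θlo - 1 / 2) u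
  have hcorr : S.corr sg hsg am l δ ham hl hδ hδ8 hl_le hδ_room hδ_up hδ_clean hη1 hℓη hρη haε 1 (u - n) = 0 := by
    rcases S.corr_eq sg hsg am l δ ham hl hδ hδ8 hl_le hδ_room hδ_up hδ_clean hη1 hℓη hρη haε 1 (u - n) with h | ⟨hvI, -, -, h⟩
    · exact h
    · rw [h, sub_eq_zero]
      have hm : S.moving sg hsg am l δ ham hl hδ hδ8 hl_le hδ_room hδ_up hδ_clean ((2 * π)⁻¹ * (S.md sg hsg am l δ ham hl hδ hδ8 hl_le hδ_room hδ_up hδ_clean).seg'.θhat (u - n), 1) = ((S.md sg hsg am l δ ham hl hδ hδ8 hl_le hδ_room hδ_up hδ_clean).piece.pMid (u - n), 1) := by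
        rw [moving, KnotPiece.pMid, ← S.piece_k_eq sg hsg am l δ ham hl hδ hδ8 hl_le hδ_room hδ_up hδ_clean, ← mul_assoc, mul_inv_cancel₀ (by positivity), one_mul,
          D.collar₁ _ 1 (by linarith [D.η_pos])]
      rw [hm, S.c₀_mid sg hsg am l δ ham hl hδ hδ8 hl_le hδ_room hδ_up hδ_clean hη1 hℓη hρη haε ⟨hvI.1, hvI.2.le⟩]
  simp only [surf, periodise]
  rw [hn, hcorr, add_zero, c₀_c]
  rfl

/-- **The slice at `s = 2` is the static detour of the upper piece.** [folklore] -/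
theorem surfaceDetour_c_two (u : ℝ) : (S.surfaceDetour sg hsg am l δ ham hl hδ hδ8 hl_le hδ_room hδ_up hδ_clean hη1 hℓη hρη haε).c (u, 2) =
    (((KnotPiece.detour (S.tubeFit₂' sg hsg am l δ ham hl hδ hδ8 hl_le hδ_room hδ_up hδ_clean hη1 hℓη hρη haε)).κθ u, 2), (KnotPiece.detour (S.tubeFit₂' sg hsg am l δ ham hl hδ hδ8 hl_le hδ_room hδ_up hδ_clean hη1 hℓη hρη haε)).κd u) := by
  rw [surfaceDetour_c]
  obtain ⟨n, hn⟩ := exists_toIcoMod_one_eq ((S.md sg hsg am l δ ham hl hδ hδ8 hl_le hδ_room hδ_up hδ_clean).chart.θlo - 1 / 2) u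
  have hvmem : u - n ∈ Ico ((S.md sg hsg am l δ ham hl hδ hδ8 hl_le hδ_room hδ_up hδ_clean).chart.θlo - 1 / 2) ((S.md sg hsg am l δ ham hl hδ hδ8 hl_le hδ_room hδ_up hδ_clean).chart.θlo + 1 / 2) := by
    have h := toIcoMod_one_mem ((S.md sg hsg am l δ ham hl hδ hδ8 hl_le hδ_room hδ_up hδ_clean).chart.θlo - 1 / 2) u
    rw [hn] at h
    exact ⟨h.1, by linarith [h.2]⟩
  -- both sides through the glued curves over the reduced parameter
  have hidx : KnotPiece.idx (C := (S.md sg hsg am l δ ham hl hδ hδ8 hl_le hδ_room hδ_up hδ_clean).chart) u = n := KnotPiece.idx_eq hvmem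
  have hper₁ : (S.md sg hsg am l δ ham hl hδ hδ8 hl_le hδ_room hδ_up hδ_clean).piece.per u = (S.md sg hsg am l δ ham hl hδ hδ8 hl_le hδ_room hδ_up hδ_clean).piece.curve (u - n) + (n : ℝ) • ChartData.e3 0 := by
    rw [KnotPiece.per, hidx]
  have hper₂ : (S.piece₂ sg hsg am l δ ham hl hδ hδ8 hl_le hδ_room hδ_up hδ_clean).per u = (S.piece₂ sg hsg am l δ ham hl hδ hδ8 hl_le hδ_room hδ_up hδ_clean).curve (u - n) + (n : ℝ) • ChartData.e3 0 := by
    rw [KnotPiece.per, hidx]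
  have hR : ((((KnotPiece.detour (S.tubeFit₂' sg hsg am l δ ham hl hδ hδ8 hl_le hδ_room hδ_up hδ_clean hη1 hℓη hρη haε)).κθ u, (2 : ℝ)),
      (KnotPiece.detour (S.tubeFit₂' sg hsg am l δ ham hl hδ hδ8 hl_le hδ_room hδ_up hδ_clean hη1 hℓη hρη haε)).κd u) : (ℝ × ℝ) × (ℝ × ℝ)) =
      shuffle ((S.piece₂ sg hsg am l δ ham hl hδ hδ8 hl_le hδ_room hδ_up hδ_clean).curve (u - n), 2) + (((n : ℝ), 0), (0, 0)) := by
    rw [KnotPiece.detour_κθ, KnotPiece.detour_κd]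
    simp only [KnotPiece.κθ, KnotPiece.κd, hper₂]
    exact shuffle_add_e3 _ _ _
  have hL : (S.c₀ sg hsg am l δ ham hl hδ hδ8 hl_le hδ_room hδ_up hδ_clean hη1 hℓη hρη haε).c (u, 2) = shuffle ((S.md sg hsg am l δ ham hl hδ hδ8 hl_le hδ_room hδ_up hδ_clean).piece.curve (u - n), 2) + (((n : ℝ), 0), (0, 0)) := by
    rw [c₀_c]
    simp only [KnotPiece.κθ, KnotPiece.κd, hper₁]
    exact shuffle_add_e3 _ _ _
  simp only [surf, periodise]
  rw [hn, hR, hL]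
  rcases S.corr_eq sg hsg am l δ ham hl hδ hδ8 hl_le hδ_room hδ_up hδ_clean hη1 hℓη hρη haε 2 (u - n) with h | ⟨hvI, -, hz, h⟩
  · -- no correction: the curves agree
    rw [h, add_zero]
    by_cases hb : u - n ∈ Ioo (S.md sg hsg am l δ ham hl hδ hδ8 hl_le hδ_room hδ_up hδ_clean).seg'.uA (S.md sg hsg am l δ ham hl hδ hδ8 hl_le hδ_room hδ_up hδ_clean).seg'.uD ∧ ¬ S.Zone ((S.md sg hsg am l δ ham hl hδ hδ8 hl_le hδ_room hδ_up hδ_clean).seg'.θhat (u - n))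
    · -- on the body the correction is the full difference, so it vanishing means the curves agree there too
      have h1 := S.χ_eq_one_of_not_zone sg hsg am l δ ham hl hδ hδ8 hl_le hδ_room hδ_up hδ_clean ⟨hb.1.1, hb.1.2.le⟩ hb.2
      have h2 : S.corr sg hsg am l δ ham hl hδ hδ8 hl_le hδ_room hδ_up hδ_clean hη1 hℓη hρη haε 2 (u - n) =
          shuffle (S.moving sg hsg am l δ ham hl hδ hδ8 hl_le hδ_room hδ_up hδ_clean ((2 * π)⁻¹ * (S.md sg hsg am l δ ham hl hδ hδ8 hl_le hδ_room hδ_up hδ_clean).seg'.θhat (u - n), 2)) - (S.c₀ sg hsg am l δ ham hl hδ hδ8 hl_le hδ_room hδ_up hδ_clean hη1 hℓη hρη haε).c (u - n, 2) := by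
        simp only [corr]; rw [h1, one_smul]
      rw [h2, sub_eq_zero, S.c₀_mid sg hsg am l δ ham hl hδ hδ8 hl_le hδ_room hδ_up hδ_clean hη1 hℓη hρη haε ⟨hb.1.1, hb.1.2.le⟩] at h
      have hm : S.moving sg hsg am l δ ham hl hδ hδ8 hl_le hδ_room hδ_up hδ_clean ((2 * π)⁻¹ * (S.md sg hsg am l δ ham hl hδ hδ8 hl_le hδ_room hδ_up hδ_clean).seg'.θhat (u - n), 2) = ((S.piece₂ sg hsg am l δ ham hl hδ hδ8 hl_le hδ_room hδ_up hδ_clean).pMid (u - n), 2) := by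
        rw [moving, KnotPiece.pMid, ← S.piece₂_k_eq sg hsg am l δ ham hl hδ hδ8 hl_le hδ_room hδ_up hδ_clean, ← mul_assoc, mul_inv_cancel₀ (by positivity), one_mul,
          D.collar₂ _ 2 (by linarith [D.η_pos])]
      rw [hm] at h
      have hc : (S.piece₂ sg hsg am l δ ham hl hδ hδ8 hl_le hδ_room hδ_up hδ_clean).pMid (u - n) = (S.md sg hsg am l δ ham hl hδ hδ8 hl_le hδ_room hδ_up hδ_clean).piece.pMid (u - n) := by
        have := shuffle_injective h
        exact congrArg Prod.fst this
      rw [(S.piece₂ sg hsg am l δ ham hl hδ hδ8 hl_le hδ_room hδ_up hδ_clean).curve_of_mem_mid ⟨hb.1.1, hb.1.2.le⟩, (S.md sg hsg am l δ ham hl hδ hδ8 hl_le hδ_room hδ_up hδ_clean).piece.curve_of_mem_mid ⟨hb.1.1, hb.1.2.le⟩, hc]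
    · rw [S.curve₂_eq sg hsg am l δ ham hl hδ hδ8 hl_le hδ_room hδ_up hδ_clean (by tauto)]
  · -- the body: the correction swaps the middle pieces
    rw [h]
    have hm : S.moving sg hsg am l δ ham hl hδ hδ8 hl_le hδ_room hδ_up hδ_clean ((2 * π)⁻¹ * (S.md sg hsg am l δ ham hl hδ hδ8 hl_le hδ_room hδ_up hδ_clean).seg'.θhat (u - n), 2) = ((S.piece₂ sg hsg am l δ ham hl hδ hδ8 hl_le hδ_room hδ_up hδ_clean).pMid (u - n), 2) := by
      rw [moving, KnotPiece.pMid, ← S.piece₂_k_eq sg hsg am l δ ham hl hδ hδ8 hl_le hδ_room hδ_up hδ_clean, ← mul_assoc, mul_inv_cancel₀ (by positivity), one_mul,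
        D.collar₂ _ 2 (by linarith [D.η_pos])]
    rw [hm, S.c₀_mid sg hsg am l δ ham hl hδ hδ8 hl_le hδ_room hδ_up hδ_clean hη1 hℓη hρη haε ⟨hvI.1, hvI.2.le⟩, (S.piece₂ sg hsg am l δ ham hl hδ hδ8 hl_le hδ_room hδ_up hδ_clean).curve_of_mem_mid ⟨hvI.1, hvI.2.le⟩,
      (S.md sg hsg am l δ ham hl hδ hδ8 hl_le hδ_room hδ_up hδ_clean).piece.curve_of_mem_mid ⟨hvI.1, hvI.2.le⟩]
    abel

end

end StripPicture

end Literature.Topology.FourManifolds
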